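import Literature.NumberTheory.LFunctions.BurnolNymanCriterionProofs
import Mathlib.Analysis.Calculus.MeanValue
import Mathlib.Analysis.Calculus.ContDiff.Deriv
import Mathlib.Analysis.SpecialFunctions.SmoothTransition
import Mathlib.Analysis.SumIntegralComparisons
import Mathlib.MeasureTheory.Integral.IntegralEqImproper
import HarnessLib

/-!
# Burnol 2001, Thm 2.6 (the periodization criterion) — discharge of `Burnol2001_thm_2_6`

LABEL (line 1): `Literature.NumberTheory.LFunctions.Burnol2001_thm_2_6` is an RH-EQUIVALENT·PRINTED
criterion; this file PROVES THE EQUIVALENCE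
`RiemannHypothesis ↔ (𝟏 ∈ closure_{L²(0,1)} {T(φ) : φ ∈ 𝒮⁰_{≤1}})` AS AN EQUIVALENCE — neither side
is asserted. bears_on: LADDER-RH B-C/B-P (COLUMN 6 DBR). WHAT THIS IS NOT: a proof or disproof of
RH; a proved criterion fixes WHICH closure statement would prove RH, it does not move RH; nothing
here bears on the truth of RH.

Here `T(φ)(u) = Σ_{n ≥ 1} φ(nu)` (`Literature.NumberTheory.LFunctions.Burnol2001.mapT`) and
`𝒮⁰_{≤1}` = smooth `φ` supported in `[0,1]` with `∫_0^1 φ = 0`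
(`Literature.NumberTheory.LFunctions.Burnol2001.IsTest0`).

## The proof

Burnol (TeX l.420–463) derives Thm 2.6 from the Beurling–Lax description of the dilation-invariant
subspaces of `H²` ("`K` coincides with the space `N` considered by Nyman"). We follow the
ELEMENTARY road that the same paragraph makes available, reducing to Nyman's criterion
(`Burnol2001_thm_2_1_holds`, itself reduced to the tree's Báez-Duarte theorem):

* `⟸` (closure ⟹ RH), as printed (l.425–440): `T(φ)` is supported in `(0,1]`, bounded
  (`|u T(φ)(u) − ∫φ| ≤ 2Lu` and `∫φ = 0`), and its Mellin transform is `ζ(s)·φ̂(s)` — for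
  `Re s > 1` by termwise integration, "hence by analytic continuation" on `Re s > 0` (identity
  theorem, with Mathlib's entire `riemannZeta₁`). At a zero `s₀` of `ζ` with `½ < Re s₀ < 1` every
  `T(φ)` is thus Mellin-orthogonal to `u^{s₀−1}` while `∫_0^1 u^{s₀−1} = 1/s₀ ≠ 0`; Cauchy–Schwarz and
  `ε → 0` give the contradiction, and `quasiRiemannHypothesis_one_half_iff_holds` finishes.
* `⟹` (RH ⟹ closure): by Nyman's criterion `𝟏` is an `L²(0,1)`-limit of combinations of the
  `ρ_α`; and each `ρ_α` is an `L²(0,1)`-limit of `T(φ)`'s, `φ ∈ 𝒮⁰_{≤1}` (so `N ⊂ K`), because of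
  the IDENTITY `ρ_α = T(α·𝟙_{(0,1]} − 𝟙_{(0,α]})` (`{α/u} − α{1/u} = α⌊1/u⌋ − ⌊α/u⌋`) and a smooth
  approximation `φ = α'χ_{1,δ} − χ_{α,δ}` of that step function by `smoothTransition` bumps
  (`χ_{a,δ} = 1` on `[δ, a−δ]`, `∫χ_{a,δ} = a − δ`, `α' = (α−δ)/(1−δ)` so that `∫φ = 0`): near `0`
  the unimodal Riemann-sum bound `|u Σ_n χ(nu) − ∫χ| ≤ u` keeps `|T(φ) − ρ_α| ≤ 3`, and away from
  `0` the finitely many dilates of `φ − (α𝟙_{(0,1]} − 𝟙_{(0,α]})` are `L²`-small.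

No new definitions of objects of the paper beyond proof-internal ones; no new named facts (net
debt −1).

## References
* [Burnol2001] J.-F. Burnol, *An adelic causality problem related to abelian L-functions*,
  J. Number Theory 87 (2001) 253–269 = arXiv:math/0001013v3, Thm 2.6 (TeX l.460–463) and the
  paragraph l.420–459 (`T(φ)`, `T̂(φ)(s) = ζ(s)φ̂(s)`, `K = N`).
* [Nyman1950] B. Nyman, Thesis, Uppsala 1950 (via `Burnol2001_thm_2_1_holds`).
-/

noncomputable section

open Complex Filter MeasureTheory Set Asymptotics
open scoped Real Topology ContDiff

namespace Literature.NumberTheory.LFunctions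

namespace Burnol2001

namespace IsTest0

variable {φ : ℝ → ℂ}

/-! ## Elementary properties of `φ ∈ 𝒮⁰_{≤1}` -/

/-- `φ ∈ 𝒮⁰_{≤1}` vanishes at every `x > 1`. [cite: Burnol2001, §2 (before Thm 2.6)] -/
theorem eq_zero_of_one_lt (hφ : IsTest0 φ) {x : ℝ} (hx : 1 < x) : φ x = 0 := by
  by_contra h
  have hmem := hφ.2.1 (Function.mem_support.2 h)
  exact absurd hmem.2 (not_le.2 hx)

/-- `φ ∈ 𝒮⁰_{≤1}` vanishes at every `x < 0`. [cite: Burnol2001, §2 (before Thm 2.6)] -/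
theorem eq_zero_of_neg (hφ : IsTest0 φ) {x : ℝ} (hx : x < 0) : φ x = 0 := by
  by_contra h
  have hmem := hφ.2.1 (Function.mem_support.2 h)
  exact absurd hmem.1 (not_le.2 hx)

/-- `φ ∈ 𝒮⁰_{≤1}` is continuous. [cite: Burnol2001, §2 (before Thm 2.6)] -/
theorem continuous (hφ : IsTest0 φ) : Continuous φ := hφ.1.continuous

/-- `φ ∈ 𝒮⁰_{≤1}` is differentiable. [cite: Burnol2001, §2 (before Thm 2.6)] -/
theorem differentiable (hφ : IsTest0 φ) : Differentiable ℝ φ :=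
  hφ.1.differentiable (by simp)

/-- The derivative of `φ ∈ 𝒮⁰_{≤1}` vanishes on `(1, ∞)`. [cite: Burnol2001, §2 (before Thm 2.6)] -/
theorem deriv_eq_zero_of_one_lt (hφ : IsTest0 φ) {x : ℝ} (hx : 1 < x) : deriv φ x = 0 := by
  have h : φ =ᶠ[𝓝 x] fun _ ↦ (0 : ℂ) := by
    filter_upwards [Ioi_mem_nhds hx] with y hy using hφ.eq_zero_of_one_lt hy
  rw [h.deriv_eq, deriv_const]

/-- `φ ∈ 𝒮⁰_{≤1}` is Lipschitz on `[0, ∞)` with some constant `L ≥ 0` (`L = sup |φ′|`).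
[cite: Burnol2001, §2 (before Thm 2.6)] -/
theorem exists_lipschitz (hφ : IsTest0 φ) :
    ∃ L : ℝ, 0 ≤ L ∧ ∀ x y : ℝ, 0 ≤ x → 0 ≤ y → ‖φ y - φ x‖ ≤ L * |y - x| := by
  have hcont : Continuous (deriv φ) := hφ.1.continuous_deriv (by simp)
  obtain ⟨L, hL⟩ := (isCompact_Icc (a := (0 : ℝ)) (b := 2)).exists_bound_of_continuousOn
    hcont.continuousOn
  have hL0 : 0 ≤ L := (norm_nonneg _).trans (hL 0 (by simp))
  refine ⟨L, hL0, fun x y hx hy ↦ ?_⟩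
  have hbound : ∀ z ∈ Ici (0 : ℝ), ‖deriv φ z‖ ≤ L := by
    intro z hz
    by_cases hz2 : z ≤ 2
    · exact hL z ⟨hz, hz2⟩
    · rw [hφ.deriv_eq_zero_of_one_lt (by linarith), norm_zero]; exact hL0
  have := (convex_Ici (0 : ℝ)).norm_image_sub_le_of_norm_deriv_le
    (fun z _ ↦ hφ.differentiable.differentiableAt) hbound hx hy
  simpa [Real.norm_eq_abs] using this

/-- `φ ∈ 𝒮⁰_{≤1}` is bounded: `‖φ x‖ ≤ L` for the Lipschitz constant `L` (`φ(0) = 0`... rather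
`φ(2) = 0` and the Lipschitz bound on `[0, ∞)`; `φ = 0` on `(−∞, 0)`).
[cite: Burnol2001, §2 (before Thm 2.6)] -/
theorem norm_le_of_lipschitz (hφ : IsTest0 φ) {L : ℝ} (hL0 : 0 ≤ L)
    (hL : ∀ x y : ℝ, 0 ≤ x → 0 ≤ y → ‖φ y - φ x‖ ≤ L * |y - x|) (x : ℝ) : ‖φ x‖ ≤ 2 * L := by
  by_cases hx : x < 0
  · rw [hφ.eq_zero_of_neg hx, norm_zero]; positivity
  by_cases hx1 : 1 < x
  · rw [hφ.eq_zero_of_one_lt hx1, norm_zero]; positivity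
  push Not at hx hx1
  have h2 : φ 2 = 0 := hφ.eq_zero_of_one_lt (by norm_num)
  have := hL 2 x (by norm_num) hx
  rw [h2, sub_zero] at this
  refine this.trans ?_
  have : |x - 2| ≤ 2 := by rw [abs_le]; constructor <;> linarith
  nlinarith

/-! ## `T(φ)` is a finite sum; support in `(0,1]` -/

/-- For `u > 0` and `M ≥ 1/u`, the terms `φ((n+1)u)` with `n ≥ M` vanish.
[cite: Burnol2001, §2 (before Thm 2.6)] -/
theorem term_eq_zero (hφ : IsTest0 φ) {u : ℝ} (hu : 0 < u) {M : ℕ} (hM : 1 / u ≤ M) {n : ℕ}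
    (hn : M ≤ n) : φ ((n + 1 : ℕ) * u) = 0 := by
  apply hφ.eq_zero_of_one_lt
  have h1 : (1 : ℝ) ≤ M * u := by
    rw [div_le_iff₀ hu] at hM; exact hM
  have h2 : (M : ℝ) * u < (n + 1 : ℕ) * u := by
    apply mul_lt_mul_of_pos_right _ hu
    exact_mod_cast Nat.lt_succ_of_le hn
  linarith

/-- For `u > 0` and `M ≥ 1/u`: `T(φ)(u) = Σ_{n<M} φ((n+1)u)`. [cite: Burnol2001, §2 (before Thm 2.6)] -/
theorem mapT_eq_sum_range (hφ : IsTest0 φ) {u : ℝ} (hu : 0 < u) {M : ℕ} (hM : 1 / u ≤ M) :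
    mapT φ u = ∑ n ∈ Finset.range M, φ ((n + 1 : ℕ) * u) := by
  apply tsum_eq_sum
  intro n hn
  rw [Finset.mem_range, not_lt] at hn
  exact hφ.term_eq_zero hu hM hn

/-- For `u > 1`, `T(φ)(u) = 0` ("`T(φ)` has support in `(0,1]`").
[cite: Burnol2001, §2 (before Thm 2.6)] -/
theorem mapT_eq_zero_of_one_lt (hφ : IsTest0 φ) {u : ℝ} (hu : 1 < u) : mapT φ u = 0 := by
  have hu0 : 0 < u := zero_lt_one.trans hu
  have hM : 1 / u ≤ (1 : ℕ) := by
    rw [Nat.cast_one, div_le_one hu0]; exact hu.le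
  rw [hφ.mapT_eq_sum_range hu0 hM, Finset.sum_range_one]
  apply hφ.eq_zero_of_one_lt
  simpa using hu

/-! ## Integrals of `φ` -/

/-- `φ ∈ 𝒮⁰_{≤1}` is interval-integrable. [cite: Burnol2001, §2 (before Thm 2.6)] -/
theorem intervalIntegrable (hφ : IsTest0 φ) (a b : ℝ) : IntervalIntegrable φ volume a b :=
  hφ.continuous.intervalIntegrable a b

/-- `∫_0^∞ φ = ∫_0^T φ` for `T ≥ 1`. [cite: Burnol2001, §2 (before Thm 2.6)] -/
theorem integral_Ioi_eq (hφ : IsTest0 φ) {T : ℝ} (hT : 1 ≤ T) :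
    ∫ x in Ioi (0 : ℝ), φ x = ∫ x in (0 : ℝ)..T, φ x := by
  have hT0 : (0 : ℝ) ≤ T := zero_le_one.trans hT
  have hzero : ∀ x ∈ Ioi T, φ x = 0 := fun x hx ↦ hφ.eq_zero_of_one_lt (lt_of_le_of_lt hT hx)
  rw [intervalIntegral.integral_of_le hT0, ← Ioc_union_Ioi_eq_Ioi hT0,
    setIntegral_union (Set.Ioc_disjoint_Ioi le_rfl) measurableSet_Ioi
      ((hφ.intervalIntegrable 0 T).1) (integrableOn_zero.congr_fun (fun x hx ↦ (hzero x hx).symm)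
        measurableSet_Ioi),
    setIntegral_eq_zero_of_forall_eq_zero hzero, add_zero]

/-- `∫_0^∞ φ = 0` for `φ ∈ 𝒮⁰_{≤1}` (the defining mean-zero condition `∫_0^1 φ = 0`).
[cite: Burnol2001, §2 (before Thm 2.6)] -/
theorem integral_Ioi_eq_zero (hφ : IsTest0 φ) : ∫ x in Ioi (0 : ℝ), φ x = 0 := by
  rw [hφ.integral_Ioi_eq le_rfl, intervalIntegral.integral_of_le zero_le_one,
    ← integral_Icc_eq_integral_Ioc]
  exact hφ.2.2

/-! ## The Riemann-sum estimate: `T(φ)` is bounded on `(0,1]` -/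

/-- For `0 < u ≤ 1`: `‖u Σ_{n≥1} φ(nu) − ∫_0^∞ φ‖ ≤ 2 L u`, `L` a Lipschitz constant of `φ` on
`[0, ∞)` (Riemann sum versus integral, cell by cell). [cite: Burnol2001, §2 (before Thm 2.6)] -/
theorem norm_mul_mapT_sub_integral_le (hφ : IsTest0 φ) {L : ℝ} (hL0 : 0 ≤ L)
    (hL : ∀ x y : ℝ, 0 ≤ x → 0 ≤ y → ‖φ y - φ x‖ ≤ L * |y - x|) {u : ℝ} (hu : 0 < u)
    (hu1 : u ≤ 1) :
    ‖(u : ℂ) * mapT φ u - ∫ x in Ioi (0 : ℝ), φ x‖ ≤ 2 * L * u := by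
  set M : ℕ := ⌈1 / u⌉₊ with hMdef
  have hM : 1 / u ≤ M := Nat.le_ceil _
  have hM' : (M : ℝ) ≤ 1 / u + 1 := (Nat.ceil_lt_add_one (div_nonneg zero_le_one hu.le)).le
  have hMu : 1 ≤ (M : ℝ) * u := by rwa [div_le_iff₀ hu] at hM
  rw [hφ.mapT_eq_sum_range hu hM, hφ.integral_Ioi_eq hMu]
  have hadj := intervalIntegral.sum_integral_adjacent_intervals (μ := volume) (f := φ)
    (a := fun k : ℕ ↦ (k : ℝ) * u) (n := M) (fun k _ ↦ hφ.intervalIntegrable _ _)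
  simp only [Nat.cast_zero, zero_mul] at hadj
  rw [← hadj, Finset.mul_sum, ← Finset.sum_sub_distrib]
  have hterm : ∀ n ∈ Finset.range M,
      ‖(u : ℂ) * φ ((n + 1 : ℕ) * u) - ∫ x in ((n : ℕ) : ℝ) * u..((n + 1 : ℕ) : ℝ) * u, φ x‖ ≤
        L * u * u := by
    intro n _
    have hlen : ((n + 1 : ℕ) : ℝ) * u - (n : ℕ) * u = u := by push_cast; ring
    have hle : ((n : ℕ) : ℝ) * u ≤ ((n + 1 : ℕ) : ℝ) * u := by
      apply mul_le_mul_of_nonneg_right _ hu.le; exact_mod_cast Nat.le_succ n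
    have hconst : (u : ℂ) * φ ((n + 1 : ℕ) * u) =
        ∫ _ in ((n : ℕ) : ℝ) * u..((n + 1 : ℕ) : ℝ) * u, φ ((n + 1 : ℕ) * u) := by
      rw [intervalIntegral.integral_const, hlen, Complex.real_smul]
    rw [hconst, ← intervalIntegral.integral_sub intervalIntegrable_const (hφ.intervalIntegrable _ _)]
    have hb := intervalIntegral.norm_integral_le_of_norm_le_const (a := ((n : ℕ) : ℝ) * u)
      (b := ((n + 1 : ℕ) : ℝ) * u) (C := L * u) (f := fun x ↦ φ ((n + 1 : ℕ) * u) - φ x) ?_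
    · rw [hlen, abs_of_pos hu] at hb
      exact hb
    · intro x hx
      rw [Set.uIoc_of_le hle] at hx
      have hx0 : 0 ≤ x := le_trans (mul_nonneg (Nat.cast_nonneg n) hu.le) hx.1.le
      have hy0 : 0 ≤ ((n + 1 : ℕ) : ℝ) * u := mul_nonneg (Nat.cast_nonneg _) hu.le
      calc ‖φ ((n + 1 : ℕ) * u) - φ x‖ ≤ L * |((n + 1 : ℕ) : ℝ) * u - x| := hL x _ hx0 hy0
        _ ≤ L * u := by
          apply mul_le_mul_of_nonneg_left _ hL0
          rw [abs_of_nonneg (by linarith [hx.2])]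
          linarith [hx.1, hlen]
  calc ‖∑ n ∈ Finset.range M, ((u : ℂ) * φ ((n + 1 : ℕ) * u) -
          ∫ x in ((n : ℕ) : ℝ) * u..((n + 1 : ℕ) : ℝ) * u, φ x)‖
      ≤ ∑ n ∈ Finset.range M, L * u * u := norm_sum_le_of_le _ hterm
    _ = M * (L * u * u) := by simp
    _ ≤ (1 / u + 1) * (L * u * u) :=
        mul_le_mul_of_nonneg_right hM' (mul_nonneg (mul_nonneg hL0 hu.le) hu.le)
    _ = L * u + L * u * u := by field_simp
    _ ≤ 2 * L * u := by nlinarith [mul_le_mul_of_nonneg_left hu1 (mul_nonneg hL0 hu.le)]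

/-- For `0 < u ≤ 1`: `‖T(φ)(u)‖ ≤ 2L` (since `∫φ = 0`). [cite: Burnol2001, §2 (before Thm 2.6)] -/
theorem norm_mapT_le (hφ : IsTest0 φ) {L : ℝ} (hL0 : 0 ≤ L)
    (hL : ∀ x y : ℝ, 0 ≤ x → 0 ≤ y → ‖φ y - φ x‖ ≤ L * |y - x|) {u : ℝ} (hu : 0 < u)
    (hu1 : u ≤ 1) : ‖mapT φ u‖ ≤ 2 * L := by
  have h := hφ.norm_mul_mapT_sub_integral_le hL0 hL hu hu1
  rw [hφ.integral_Ioi_eq_zero, sub_zero, norm_mul, Complex.norm_real, Real.norm_eq_abs,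
    abs_of_pos hu] at h
  have : u * ‖mapT φ u‖ ≤ u * (2 * L) := by linarith
  exact le_of_mul_le_mul_left this hu

/-- `T(φ)` is bounded on `(0, ∞)`: `‖T(φ)(u)‖ ≤ 2L` for all `u > 0`.
[cite: Burnol2001, §2 (before Thm 2.6)] -/
theorem norm_mapT_le' (hφ : IsTest0 φ) {L : ℝ} (hL0 : 0 ≤ L)
    (hL : ∀ x y : ℝ, 0 ≤ x → 0 ≤ y → ‖φ y - φ x‖ ≤ L * |y - x|) {u : ℝ} (hu : 0 < u) :
    ‖mapT φ u‖ ≤ 2 * L := by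
  by_cases hu1 : u ≤ 1
  · exact hφ.norm_mapT_le hL0 hL hu hu1
  · rw [hφ.mapT_eq_zero_of_one_lt (not_le.1 hu1), norm_zero]; positivity

/-- `T(φ)` is continuous on `(0, ∞)` (locally a finite sum of continuous functions).
[cite: Burnol2001, §2 (before Thm 2.6)] -/
theorem continuousOn_mapT (hφ : IsTest0 φ) : ContinuousOn (mapT φ) (Ioi 0) := by
  intro u₀ hu₀
  have hu₀' : (0 : ℝ) < u₀ := hu₀
  set M : ℕ := ⌈1 / (u₀ / 2)⌉₊ with hM
  have hloc : ∀ u ∈ Ioi (u₀ / 2), mapT φ u = ∑ n ∈ Finset.range M, φ ((n + 1 : ℕ) * u) := by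
    intro u hu
    have hu' : (0 : ℝ) < u := lt_trans (half_pos hu₀') hu
    have hMu : 1 / u ≤ M := by
      refine le_trans ?_ (Nat.le_ceil _)
      exact one_div_le_one_div_of_le (half_pos hu₀') (le_of_lt hu)
    rw [hφ.mapT_eq_sum_range hu' hMu]
  have hcont : ContinuousOn (fun u : ℝ ↦ ∑ n ∈ Finset.range M, φ ((n + 1 : ℕ) * u))
      (Ioi (u₀ / 2)) :=
    (continuous_finsetSum _ fun n _ ↦
      hφ.continuous.comp (continuous_const.mul continuous_id)).continuousOn
  have hmem : Ioi (u₀ / 2) ∈ 𝓝 u₀ := Ioi_mem_nhds (by linarith)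
  have key : ContinuousAt (mapT φ) u₀ := by
    have h1 : ContinuousAt (fun u : ℝ ↦ ∑ n ∈ Finset.range M, φ ((n + 1 : ℕ) * u)) u₀ :=
      hcont.continuousAt hmem
    refine h1.congr ?_
    filter_upwards [hmem] with u hu using (hloc u hu).symm
  exact key.continuousWithinAt

/-- `T(φ)` is a.e.-strongly measurable on `(0, ∞)`. [cite: Burnol2001, §2 (before Thm 2.6)] -/
theorem aestronglyMeasurable_mapT (hφ : IsTest0 φ) :
    AEStronglyMeasurable (mapT φ) (volume.restrict (Ioi (0 : ℝ))) :=
  hφ.continuousOn_mapT.aestronglyMeasurable measurableSet_Ioi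

/-! ## Mellin transforms: `φ̂` and `T̂(φ) = ζ · φ̂` -/

/-- The Mellin transform of `φ ∈ 𝒮⁰_{≤1}` converges absolutely for `0 < Re s` (`φ` is bounded
and vanishes on `(1,∞)`). [cite: Burnol2001, §2 (before Thm 2.6)] -/
theorem mellinConvergent (hφ : IsTest0 φ) {s : ℂ} (hs : 0 < s.re) : MellinConvergent φ s := by
  obtain ⟨L, hL0, hL⟩ := hφ.exists_lipschitz
  refine mellinConvergent_of_isBigO_rpow (a := s.re + 1) (b := 0)
    (hφ.continuous.continuousOn.locallyIntegrableOn measurableSet_Ioi) ?_ (by linarith) ?_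
    (by simpa using hs)
  · have h0 : φ =ᶠ[atTop] 0 := by
      filter_upwards [eventually_gt_atTop 1] with t ht using hφ.eq_zero_of_one_lt ht
    exact (isBigO_zero _ _).congr' h0.symm EventuallyEq.rfl
  · refine IsBigO.of_bound (2 * L) ?_
    filter_upwards [self_mem_nhdsWithin] with t (ht : 0 < t)
    simpa [Real.rpow_zero] using hφ.norm_le_of_lipschitz hL0 hL t

/-- The Mellin transform `φ̂` of `φ ∈ 𝒮⁰_{≤1}` is holomorphic on `0 < Re s` (in fact entire; this
half-plane suffices). [cite: Burnol2001, §2 (before Thm 2.6)] -/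
theorem differentiableAt_mellin (hφ : IsTest0 φ) {s : ℂ} (hs : 0 < s.re) :
    DifferentiableAt ℂ (mellin φ) s := by
  obtain ⟨L, hL0, hL⟩ := hφ.exists_lipschitz
  refine mellin_differentiableAt_of_isBigO_rpow (a := s.re + 1) (b := 0)
    (hφ.continuous.continuousOn.locallyIntegrableOn measurableSet_Ioi) ?_ (by linarith) ?_
    (by simpa using hs)
  · have h0 : φ =ᶠ[atTop] 0 := by
      filter_upwards [eventually_gt_atTop 1] with t ht using hφ.eq_zero_of_one_lt ht
    exact (isBigO_zero _ _).congr' h0.symm EventuallyEq.rfl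
  · refine IsBigO.of_bound (2 * L) ?_
    filter_upwards [self_mem_nhdsWithin] with t (ht : 0 < t)
    simpa [Real.rpow_zero] using hφ.norm_le_of_lipschitz hL0 hL t

/-- The Mellin transform of `T(φ)` converges absolutely for `0 < Re s` (`T(φ)` is bounded and
supported in `(0,1]`). [cite: Burnol2001, §2 (before Thm 2.6)] -/
theorem mellinConvergent_mapT (hφ : IsTest0 φ) {s : ℂ} (hs : 0 < s.re) :
    MellinConvergent (mapT φ) s := by
  obtain ⟨L, hL0, hL⟩ := hφ.exists_lipschitz
  refine mellinConvergent_of_isBigO_rpow (a := s.re + 1) (b := 0)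
    (hφ.continuousOn_mapT.locallyIntegrableOn measurableSet_Ioi) ?_ (by linarith) ?_
    (by simpa using hs)
  · have h0 : mapT φ =ᶠ[atTop] 0 := by
      filter_upwards [eventually_gt_atTop 1] with t ht using hφ.mapT_eq_zero_of_one_lt ht
    exact (isBigO_zero _ _).congr' h0.symm EventuallyEq.rfl
  · refine IsBigO.of_bound (2 * L) ?_
    filter_upwards [self_mem_nhdsWithin] with t (ht : 0 < t)
    simpa [Real.rpow_zero] using hφ.norm_mapT_le' hL0 hL ht

/-- The Mellin transform `T̂(φ)` is holomorphic on `0 < Re s` (Burnol: "an entire function"; the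
half-plane suffices). [cite: Burnol2001, §2 (before Thm 2.6)] -/
theorem differentiableAt_mellin_mapT (hφ : IsTest0 φ) {s : ℂ} (hs : 0 < s.re) :
    DifferentiableAt ℂ (mellin (mapT φ)) s := by
  obtain ⟨L, hL0, hL⟩ := hφ.exists_lipschitz
  refine mellin_differentiableAt_of_isBigO_rpow (a := s.re + 1) (b := 0)
    (hφ.continuousOn_mapT.locallyIntegrableOn measurableSet_Ioi) ?_ (by linarith) ?_
    (by simpa using hs)
  · have h0 : mapT φ =ᶠ[atTop] 0 := by
      filter_upwards [eventually_gt_atTop 1] with t ht using hφ.mapT_eq_zero_of_one_lt ht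
    exact (isBigO_zero _ _).congr' h0.symm EventuallyEq.rfl
  · refine IsBigO.of_bound (2 * L) ?_
    filter_upwards [self_mem_nhdsWithin] with t (ht : 0 < t)
    simpa [Real.rpow_zero] using hφ.norm_mapT_le' hL0 hL ht

/-- **`T̂(φ)(s) = ζ(s) φ̂(s)` for `Re s > 1`** (termwise integration:
`∫_0^∞ φ(nu) u^{s−1} du = n^{−s} φ̂(s)` and `Σ n^{−s} = ζ(s)`).
[cite: Burnol2001, §2 (before Thm 2.6), "For `Re(s) > 1`, `T̂(φ)(s) = ζ(s)φ̂(s)`"] -/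
theorem mellin_mapT_eq_of_one_lt_re (hφ : IsTest0 φ) {s : ℂ} (hs : 1 < s.re) :
    mellin (mapT φ) s = riemannZeta s * mellin φ s := by
  have hs0 : 0 < s.re := by linarith
  obtain ⟨L, hL0, hL⟩ := hφ.exists_lipschitz
  -- the pieces `F n t = t^{s-1} φ((n+1)t)`
  set F : ℕ → ℝ → ℂ := fun n t ↦ (t : ℂ) ^ (s - 1) • φ ((n + 1 : ℕ) * t) with hF
  have hconv : MellinConvergent φ s := hφ.mellinConvergent hs0
  have hFint : ∀ n, Integrable (F n) (volume.restrict (Ioi 0)) := by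
    intro n
    have := (MellinConvergent.comp_mul_left (f := φ) (s := s) (a := ((n + 1 : ℕ) : ℝ))
      (by positivity)).2 hconv
    exact this
  -- the real majorant `g(x) = x^{σ-1} ‖φ x‖` and its integral
  set g : ℝ → ℝ := fun x ↦ x ^ (s.re - 1) * ‖φ x‖ with hg
  have hgint : Integrable g (volume.restrict (Ioi 0)) := by
    have h1 : Integrable (fun t : ℝ ↦ ‖(t : ℂ) ^ (s - 1) • φ t‖) (volume.restrict (Ioi 0)) :=
      hconv.norm
    refine h1.congr ?_
    filter_upwards [ae_restrict_mem measurableSet_Ioi] with t (ht : 0 < t)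
    simp only [hg, norm_smul, norm_cpow_eq_rpow_re_of_pos ht, sub_re, one_re]
  have hFnorm : ∀ n : ℕ, ∫ t in Ioi (0 : ℝ), ‖F n t‖ =
      ((n + 1 : ℕ) : ℝ) ^ (-s.re) * ∫ x in Ioi (0 : ℝ), g x := by
    intro n
    have hn : (0 : ℝ) < (n + 1 : ℕ) := by positivity
    have h1 : ∀ t ∈ Ioi (0 : ℝ), ‖F n t‖ =
        ((n + 1 : ℕ) : ℝ) ^ (1 - s.re) * g ((n + 1 : ℕ) * t) := by
      intro t ht
      have ht' : (0 : ℝ) < t := ht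
      simp only [hF, hg, norm_smul, norm_cpow_eq_rpow_re_of_pos ht', sub_re, one_re]
      rw [Real.mul_rpow hn.le ht'.le, ← mul_assoc, ← mul_assoc, ← Real.rpow_add hn]
      norm_num
    rw [setIntegral_congr_fun measurableSet_Ioi h1, integral_const_mul,
      integral_comp_mul_left_Ioi g 0 hn, mul_zero, smul_eq_mul, ← mul_assoc]
    congr 1
    rw [Real.rpow_sub hn, Real.rpow_one, Real.rpow_neg hn.le]
    field_simp
  have hsum : Summable fun n ↦ ∫ t in Ioi (0 : ℝ), ‖F n t‖ := by
    simp_rw [hFnorm]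
    refine Summable.mul_right _ ?_
    have h := (summable_nat_add_iff 1).2 (Real.summable_nat_rpow.2 (by linarith : -s.re < -1))
    exact_mod_cast h
  -- interchange
  have hswap : ∫ t in Ioi (0 : ℝ), ∑' n, F n t = ∑' n, ∫ t in Ioi (0 : ℝ), F n t :=
    (integral_tsum_of_summable_integral_norm hFint hsum).symm
  -- termwise values
  have hterm : ∀ n : ℕ, ∫ t in Ioi (0 : ℝ), F n t = (1 / ((n : ℂ) + 1) ^ s) * mellin φ s := by
    intro n
    have hn : (0 : ℝ) < (n + 1 : ℕ) := by positivity
    have := mellin_comp_mul_left φ s hn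
    rw [mellin] at this
    simp only [hF]
    rw [this, smul_eq_mul]
    congr 1
    have harg : (((n + 1 : ℕ) : ℝ) : ℂ).arg ≠ π := by
      rw [arg_ofReal_of_nonneg hn.le]; exact Real.pi_ne_zero.symm
    rw [cpow_neg, one_div]
    push_cast
    ring
  calc mellin (mapT φ) s = ∫ t in Ioi (0 : ℝ), ∑' n, F n t := by
        rw [mellin]
        refine setIntegral_congr_fun measurableSet_Ioi fun t _ ↦ ?_
        simp only [hF, mapT, smul_eq_mul]
        rw [tsum_mul_left]
    _ = ∑' n, ∫ t in Ioi (0 : ℝ), F n t := hswap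
    _ = ∑' n : ℕ, (1 / ((n : ℂ) + 1) ^ s) * mellin φ s := tsum_congr hterm
    _ = riemannZeta s * mellin φ s := by
        rw [tsum_mul_right, zeta_eq_tsum_one_div_nat_add_one_cpow hs]

/-- **`T̂(φ)(s) = ζ(s) φ̂(s)` on `0 < Re s`, `s ≠ 1`** ("hence by analytic continuation"): both
`(s−1)T̂(φ)(s)` and `ζ₁(s)φ̂(s)` (`ζ(s) = ζ₁(s)/(s−1)`, Mathlib's entire `riemannZeta₁`) are
holomorphic on the right half-plane and agree on `Re s > 1`.
[cite: Burnol2001, §2 (before Thm 2.6)] -/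
theorem mellin_mapT_eq (hφ : IsTest0 φ) {s : ℂ} (hs : 0 < s.re) (hs1 : s ≠ 1) :
    mellin (mapT φ) s = riemannZeta s * mellin φ s := by
  set U : Set ℂ := {z : ℂ | 0 < z.re} with hU
  set f : ℂ → ℂ := fun z ↦ (z - 1) * mellin (mapT φ) z with hf
  set g : ℂ → ℂ := fun z ↦ riemannZeta₁ z * mellin φ z with hg
  have hUo : IsOpen U := continuous_re.isOpen_preimage _ isOpen_Ioi
  have hfan : AnalyticOnNhd ℂ f U := by
    refine DifferentiableOn.analyticOnNhd (fun z hz ↦ ?_) hUo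
    exact ((differentiableAt_id.sub_const 1).mul
      (hφ.differentiableAt_mellin_mapT hz)).differentiableWithinAt
  have hgan : AnalyticOnNhd ℂ g U := by
    refine DifferentiableOn.analyticOnNhd (fun z hz ↦ ?_) hUo
    exact ((differentiable_riemannZeta₁ z).mul (hφ.differentiableAt_mellin hz)).differentiableWithinAt
  have hpre : IsPreconnected U := (convex_halfSpace_re_gt 0).isPreconnected
  have h2 : (2 : ℂ) ∈ U := by simp [hU]
  have hfg : f =ᶠ[𝓝 2] g := by
    have : ∀ᶠ z in 𝓝 (2 : ℂ), 1 < z.re :=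
      (continuous_re.isOpen_preimage _ isOpen_Ioi).mem_nhds (by simp)
    filter_upwards [this] with z hz
    have hz1 : z ≠ 1 := fun h ↦ by simp [h] at hz
    have hz2 : z - 1 ≠ 0 := sub_ne_zero.2 hz1
    simp only [hf, hg, hφ.mellin_mapT_eq_of_one_lt_re hz, riemannZeta_eq_inv_sub_mul hz1]
    field_simp
  have heq := hfan.eqOn_of_preconnected_of_eventuallyEq hgan hpre h2 hfg hs
  simp only [hf, hg] at heq
  have hs2 : s - 1 ≠ 0 := sub_ne_zero.2 hs1
  rw [riemannZeta_eq_inv_sub_mul hs1]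
  have : mellin (mapT φ) s = riemannZeta₁ s * mellin φ s / (s - 1) := by
    rw [← heq]; field_simp
  rw [this]
  field_simp

/-- At a zero `s₀` of `ζ` with `0 < Re s₀`, `s₀ ≠ 1`: `∫_0^∞ T(φ)(u) u^{s₀−1} du = 0`.
[cite: Burnol2001, §2 (before Thm 2.6)] -/
theorem hasMellin_mapT_zero (hφ : IsTest0 φ) {s : ℂ} (hs : 0 < s.re) (hs1 : s ≠ 1)
    (hζ : riemannZeta s = 0) : HasMellin (mapT φ) s 0 :=
  ⟨hφ.mellinConvergent_mapT hs, by rw [hφ.mellin_mapT_eq hs hs1, hζ, zero_mul]⟩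

end IsTest0

end Burnol2001

open Burnol2001

/-! ## Closure ⟹ RH -/

/-- **Thm 2.6, ⟸.** If `𝟏` on `(0,1)` is an `L²((0,1))`-limit of functions `T(φ)`, `φ ∈ 𝒮⁰_{≤1}`,
then the Riemann hypothesis holds: at a zero `s₀`, `½ < Re s₀ < 1`, every `T(φ)` is
Mellin-orthogonal to `u^{s₀−1}` (`hasMellin_mapT_zero`) while `∫_0^1 u^{s₀−1} du = 1/s₀ ≠ 0`
(Cauchy–Schwarz, `ε → 0`); zeros left of the line are excluded by
`quasiRiemannHypothesis_one_half_iff_holds`. [cite: Burnol2001, Thm 2.6 (⟸)] -/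
theorem riemannHypothesis_of_periodization_closure
    (h : ∀ ε : ℝ, 0 < ε → ∃ φ : ℝ → ℂ, IsTest0 φ ∧
      eLpNorm (fun u : ℝ ↦ (1 : ℂ) - mapT φ u) 2 (volume.restrict (Ioo (0 : ℝ) 1)) <
        ENNReal.ofReal ε) :
    RiemannHypothesis := by
  refine quasiRiemannHypothesis_one_half_iff_holds.1 fun s hζ hσ hσ1 ↦ ?_
  set μ0 : Measure ℝ := volume.restrict (Ioi 0) with hμ0
  have hre : 0 < s.re := by linarith
  have hs0 : s ≠ 0 := fun h0 ↦ by simp [h0] at hre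
  have hs1 : s ≠ 1 := fun h1 ↦ by simp [h1] at hσ1
  -- the test function `g = 𝟙_{(0,1]} x^{s-1}` and its (finite) `L²` norm `M`
  set g : ℝ → ℂ := (Ioc (0 : ℝ) 1).indicator fun x ↦ (x : ℂ) ^ (s - 1) with hg
  have hgm : AEStronglyMeasurable g μ0 := by
    refine (Measurable.indicator ?_ measurableSet_Ioc).aestronglyMeasurable
    exact Complex.measurable_ofReal.pow_const _
  have hgL2 : MemLp g 2 μ0 := by
    refine (memLp_two_iff_integrable_sq_norm hgm).2 ?_
    have hI : IntegrableOn (fun x : ℝ ↦ x ^ (2 * (s.re - 1))) (Ioc 0 1) μ0 :=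
      (intervalIntegral.intervalIntegrable_rpow' (a := 0) (b := 1) (by linarith)).1.restrict
    refine (hI.integrable_indicator measurableSet_Ioc).congr ?_
    filter_upwards [ae_restrict_mem measurableSet_Ioi] with x (hx : 0 < x)
    by_cases hx1 : x ∈ Ioc (0 : ℝ) 1
    · simp only [hg, indicator_of_mem hx1, norm_cpow_eq_rpow_re_of_pos hx, sub_re, one_re]
      rw [← Real.rpow_natCast, ← Real.rpow_mul hx.le]
      norm_num [mul_comm]
    · simp [hg, indicator_of_notMem hx1]
  set M : ℝ := (eLpNorm g 2 μ0).toReal with hM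
  have hM0 : 0 ≤ M := ENNReal.toReal_nonneg
  -- Key estimate: for every `ε > 0`, `‖1/s‖ ≤ ε M`.
  have key : ∀ ε : ℝ, 0 < ε → ‖(1 : ℂ) / s‖ ≤ ε * M := by
    intro ε hε
    obtain ⟨φ, hφ, hN⟩ := h ε hε
    set D : ℝ → ℂ := fun u ↦ (1 : ℂ) - mapT φ u with hD
    have hDm : AEStronglyMeasurable D μ0 :=
      aestronglyMeasurable_const.sub hφ.aestronglyMeasurable_mapT
    set Dc : ℝ → ℂ := (Ioc (0 : ℝ) 1).indicator D with hDc
    have hDcm : AEStronglyMeasurable Dc μ0 := hDm.indicator measurableSet_Ioc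
    ------------------------------------------------------------------
    -- (i) `‖Dc‖_{L²(0,∞)} = ‖D‖_{L²(0,1)} < ε`
    ------------------------------------------------------------------
    have hDc2 : eLpNorm Dc 2 μ0 < ENNReal.ofReal ε := by
      have h1 : eLpNorm Dc 2 μ0 = eLpNorm D 2 (volume.restrict (Ioo (0 : ℝ) 1)) := by
        rw [hDc, eLpNorm_indicator_eq_eLpNorm_restrict measurableSet_Ioc, hμ0,
          Measure.restrict_restrict measurableSet_Ioc, inter_eq_left.2 Ioc_subset_Ioi_self,
          Measure.restrict_congr_set (Ioo_ae_eq_Ioc (μ := (volume : Measure ℝ)) (a := 0) (b := 1))]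
      rw [h1]; exact hN
    ------------------------------------------------------------------
    -- (ii) the pairing with `x^{s-1}` on `(0,1]` equals `1/s`
    ------------------------------------------------------------------
    have hI : ∫ x in Ioi (0 : ℝ), (x : ℂ) ^ (s - 1) • Dc x = 1 / s := by
      have hlin : ∀ x ∈ Ioi (0 : ℝ), (x : ℂ) ^ (s - 1) • Dc x =
          (x : ℂ) ^ (s - 1) • (Ioc (0 : ℝ) 1).indicator (fun _ ↦ (1 : ℂ)) x -
            (x : ℂ) ^ (s - 1) • mapT φ x := by
        intro x hx
        by_cases hx1 : x ∈ Ioc (0 : ℝ) 1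
        · simp only [hDc, hD, indicator_of_mem hx1, smul_eq_mul, mul_sub]
        · have hx1' : 1 < x := by
            rw [mem_Ioc, not_and, not_le] at hx1; exact hx1 hx
          simp only [hDc, indicator_of_notMem hx1, smul_zero, hφ.mapT_eq_zero_of_one_lt hx1',
            sub_zero]
      have hint1 : Integrable (fun x : ℝ ↦ (x : ℂ) ^ (s - 1) •
          (Ioc (0 : ℝ) 1).indicator (fun _ ↦ (1 : ℂ)) x) μ0 := (hasMellin_one_Ioc hre).1
      have hmel : HasMellin (mapT φ) s 0 := hφ.hasMellin_mapT_zero hre hs1 hζ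
      rw [setIntegral_congr_fun measurableSet_Ioi hlin, integral_sub hint1 hmel.1]
      have h1 : ∫ x in Ioi (0 : ℝ), (x : ℂ) ^ (s - 1) •
          (Ioc (0 : ℝ) 1).indicator (fun _ ↦ (1 : ℂ)) x = 1 / s := (hasMellin_one_Ioc hre).2
      have h2 : ∫ x in Ioi (0 : ℝ), (x : ℂ) ^ (s - 1) • mapT φ x = 0 := hmel.2
      rw [h1, h2, sub_zero]
    ------------------------------------------------------------------
    -- (iii) Cauchy–Schwarz on `(0,1]`: the pairing has norm `≤ ε M`
    ------------------------------------------------------------------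
    have hIle : ‖∫ x in Ioi (0 : ℝ), (x : ℂ) ^ (s - 1) • Dc x‖ ≤ ε * M := by
      have hprod : (fun x : ℝ ↦ (x : ℂ) ^ (s - 1) • Dc x) = Dc • g := by
        funext x
        simp only [Pi.smul_apply', smul_eq_mul, hDc, hg]
        by_cases hx : x ∈ Ioc (0 : ℝ) 1
        · simp only [indicator_of_mem hx]; ring
        · simp only [indicator_of_notMem hx, mul_zero]
      have hH : eLpNorm (Dc • g) 1 μ0 ≤ ENNReal.ofReal ε * eLpNorm g 2 μ0 :=
        (eLpNorm_smul_le_mul_eLpNorm hgm hDcm).trans (by gcongr)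
      have hfin : ENNReal.ofReal ε * eLpNorm g 2 μ0 ≠ ⊤ :=
        ENNReal.mul_ne_top ENNReal.ofReal_ne_top hgL2.eLpNorm_lt_top.ne
      calc ‖∫ x in Ioi (0 : ℝ), (x : ℂ) ^ (s - 1) • Dc x‖
          ≤ (∫⁻ x in Ioi (0 : ℝ), ENNReal.ofReal ‖(x : ℂ) ^ (s - 1) • Dc x‖).toReal :=
            norm_integral_le_lintegral_norm _
        _ = (eLpNorm (Dc • g) 1 μ0).toReal := by
            rw [← hprod, eLpNorm_one_eq_lintegral_enorm]
            simp_rw [ofReal_norm]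
            rfl
        _ ≤ (ENNReal.ofReal ε * eLpNorm g 2 μ0).toReal := ENNReal.toReal_mono hfin hH
        _ = ε * M := by rw [ENNReal.toReal_mul, ENNReal.toReal_ofReal hε.le]
    rw [← hI]
    exact hIle
  -- Conclusion: `‖1/s‖ = 0`, absurd.
  have hpos : 0 < ‖(1 : ℂ) / s‖ := norm_pos_iff.2 (one_div_ne_zero hs0)
  have := key (‖(1 : ℂ) / s‖ / (2 * (M + 1))) (by positivity)
  have hlt : ‖(1 : ℂ) / s‖ / (2 * (M + 1)) * M < ‖(1 : ℂ) / s‖ := by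
    rw [div_mul_eq_mul_div, div_lt_iff₀ (by positivity)]
    nlinarith
  linarith


/-! ## RH ⟹ closure, step 1: smooth unimodal approximate indicators -/

namespace Burnol2001

/-- **Smooth approximate indicators.** For `0 < δ`, `2δ ≤ a` there is a smooth `χ : ℝ → ℝ` with
`χ = 0` off `(0, a)`, `χ = 1` on `[δ, a−δ]`, `0 ≤ χ ≤ 1`, monotone on `(−∞, a−δ]`, antitone on
`[δ, ∞)` and `∫_0^a χ = a − δ` — namely `χ(x) = S(x/δ) − S((x − (a−δ))/δ)` with
`S = Real.smoothTransition`. (Proof-internal smoothing of the step functions `𝟙_{(0,a]}` whose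
periodizations are Nyman's `ρ_α`, cf. `sum_indicator_Ioc_eq_floor`.)
[cite: Burnol2001, §2 (before Thm 2.6): "for a suitably chosen `φ`"] -/
theorem exists_smooth_bump {a δ : ℝ} (hδ : 0 < δ) (h2δ : 2 * δ ≤ a) :
    ∃ χ : ℝ → ℝ, ContDiff ℝ ∞ χ ∧ (∀ x, x ≤ 0 → χ x = 0) ∧ (∀ x, a ≤ x → χ x = 0) ∧
      (∀ x ∈ Icc δ (a - δ), χ x = 1) ∧ (∀ x, 0 ≤ χ x) ∧ (∀ x, χ x ≤ 1) ∧
      MonotoneOn χ (Iic (a - δ)) ∧ AntitoneOn χ (Ici δ) ∧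
      ∫ x in (0 : ℝ)..a, χ x = a - δ := by
  have hS0 : ∀ y : ℝ, y ≤ 0 → Real.smoothTransition y = 0 :=
    fun y hy ↦ Real.smoothTransition.zero_of_nonpos hy
  have hS1 : ∀ y : ℝ, 1 ≤ y → Real.smoothTransition y = 1 :=
    fun y hy ↦ Real.smoothTransition.one_of_one_le hy
  have hSm : Monotone Real.smoothTransition := Real.smoothTransition.monotone
  have haδ : δ ≤ a - δ := by linarith
  set χ : ℝ → ℝ := fun x ↦ Real.smoothTransition (x / δ) -
    Real.smoothTransition ((x - (a - δ)) / δ) with hχ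
  have hcont : Continuous χ :=
    (Real.smoothTransition.continuous.comp (continuous_id.div_const δ)).sub
      (Real.smoothTransition.continuous.comp ((continuous_id.sub continuous_const).div_const δ))
  -- values of the two transitions in the various ranges
  have hA1 : ∀ x, δ ≤ x → Real.smoothTransition (x / δ) = 1 := fun x hx ↦
    hS1 _ (by rwa [le_div_iff₀ hδ, one_mul])
  have hA0 : ∀ x, x ≤ 0 → Real.smoothTransition (x / δ) = 0 := fun x hx ↦
    hS0 _ (div_nonpos_of_nonpos_of_nonneg hx hδ.le)
  have hB0 : ∀ x, x ≤ a - δ → Real.smoothTransition ((x - (a - δ)) / δ) = 0 := fun x hx ↦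
    hS0 _ (div_nonpos_of_nonpos_of_nonneg (by linarith) hδ.le)
  have hB1 : ∀ x, a ≤ x → Real.smoothTransition ((x - (a - δ)) / δ) = 1 := fun x hx ↦
    hS1 _ (by rw [le_div_iff₀ hδ, one_mul]; linarith)
  refine ⟨χ, ?_, ?_, ?_, ?_, ?_, ?_, ?_, ?_, ?_⟩
  · exact (Real.smoothTransition.contDiff.comp (contDiff_id.div_const δ)).sub
      (Real.smoothTransition.contDiff.comp ((contDiff_id.sub contDiff_const).div_const δ))
  · intro x hx
    simp only [hχ, hA0 x hx, hB0 x (by linarith), sub_zero]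
  · intro x hx
    simp only [hχ, hA1 x (by linarith), hB1 x hx, sub_self]
  · intro x hx
    simp only [hχ, hA1 x hx.1, hB0 x hx.2, sub_zero]
  · intro x
    simp only [hχ]
    by_cases hx : x ≤ a - δ
    · rw [hB0 x hx, sub_zero]; exact Real.smoothTransition.nonneg _
    · rw [hA1 x (by linarith), sub_nonneg]; exact Real.smoothTransition.le_one _
  · intro x
    simp only [hχ]
    linarith [Real.smoothTransition.le_one (x / δ),
      Real.smoothTransition.nonneg ((x - (a - δ)) / δ)]
  · intro x hx y hy hxy
    simp only [hχ, hB0 x hx, hB0 y hy, sub_zero]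
    exact hSm (div_le_div_of_nonneg_right hxy hδ.le)
  · intro x hx y hy hxy
    have hx' : δ ≤ x := hx
    have hy' : δ ≤ y := hy
    simp only [hχ, hA1 x hx', hA1 y hy']
    have := hSm (div_le_div_of_nonneg_right (sub_le_sub_right hxy (a - δ)) hδ.le)
    linarith
  · -- the integral: `∫_0^a S(x/δ) = ∫_0^δ S(x/δ) + (a − δ)` and
    -- `∫_0^a S((x−(a−δ))/δ) = ∫_{−(a−δ)}^{δ} S(y/δ) dy = ∫_0^δ S(y/δ) dy`
    have hi : ∀ b c : ℝ, IntervalIntegrable (fun x ↦ Real.smoothTransition (x / δ)) volume b c :=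
      fun b c ↦ (Real.smoothTransition.continuous.comp (continuous_id.div_const δ)).intervalIntegrable _ _
    have hi2 : ∀ b c : ℝ, IntervalIntegrable
        (fun x ↦ Real.smoothTransition ((x - (a - δ)) / δ)) volume b c := fun b c ↦
      (Real.smoothTransition.continuous.comp
        ((continuous_id.sub continuous_const).div_const δ)).intervalIntegrable _ _
    have hI1 : ∫ x in (0 : ℝ)..a, Real.smoothTransition (x / δ) =
        (∫ x in (0 : ℝ)..δ, Real.smoothTransition (x / δ)) + (a - δ) := by
      rw [← intervalIntegral.integral_add_adjacent_intervals (hi 0 δ) (hi δ a)]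
      congr 1
      have : ∫ x in δ..a, Real.smoothTransition (x / δ) = ∫ _ in δ..a, (1 : ℝ) := by
        refine intervalIntegral.integral_congr fun x hx ↦ ?_
        rw [Set.uIcc_of_le (by linarith)] at hx
        exact hA1 x hx.1
      rw [this, intervalIntegral.integral_const, smul_eq_mul, mul_one]
    have hI2 : ∫ x in (0 : ℝ)..a, Real.smoothTransition ((x - (a - δ)) / δ) =
        ∫ x in (0 : ℝ)..δ, Real.smoothTransition (x / δ) := by
      rw [intervalIntegral.integral_comp_sub_right (fun y ↦ Real.smoothTransition (y / δ)) (a - δ),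
        zero_sub, show a - (a - δ) = δ by ring,
        ← intervalIntegral.integral_add_adjacent_intervals (hi (-(a - δ)) 0) (hi 0 δ)]
      have : ∫ x in -(a - δ)..(0 : ℝ), Real.smoothTransition (x / δ) = ∫ _ in -(a - δ)..(0 : ℝ), (0 : ℝ) := by
        refine intervalIntegral.integral_congr fun x hx ↦ ?_
        rw [Set.uIcc_of_le (by linarith)] at hx
        exact hA0 x hx.2
      rw [this, intervalIntegral.integral_const, smul_eq_mul, mul_zero, zero_add]
    simp only [hχ]
    rw [intervalIntegral.integral_sub (hi 0 a) (hi2 0 a), hI1, hI2]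
    ring

/-! ## RH ⟹ closure, step 2: Riemann sums of unimodal functions -/

/-- **Unimodal Riemann sums, unit steps.** If `f : ℝ → [0,1]` is monotone on `[0, m]` and antitone
on `[m, M]` (`m ≤ M` naturals), then `|Σ_{i=1}^{M} f(i) − ∫_0^M f| ≤ 1` (Mathlib's monotone /
antitone sum–integral comparisons on the two pieces, plus two telescoping corrections of size
`≤ 1`). [cite: Burnol2001, §2 (before Thm 2.6): behaviour of `T(φ)(u)` as `u → 0`] -/
theorem abs_sum_sub_integral_le_one {f : ℝ → ℝ} {m M : ℕ} (hmM : m ≤ M)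
    (h0 : ∀ y, 0 ≤ f y) (h1 : ∀ y, f y ≤ 1)
    (hmono : MonotoneOn f (Icc (0 : ℝ) m)) (hanti : AntitoneOn f (Icc (m : ℝ) M)) :
    |∑ i ∈ Finset.range M, f (i + 1) - ∫ y in (0 : ℝ)..M, f y| ≤ 1 := by
  -- monotone piece
  have hmono' : MonotoneOn f (Icc (0 : ℝ) ((0 : ℝ) + m)) := by rwa [zero_add]
  have hA1 : ∫ y in (0 : ℝ)..m, f y ≤ ∑ i ∈ Finset.range m, f (i + 1) := by
    have := hmono'.integral_le_sum
    simpa using this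
  have hA2 : ∑ i ∈ Finset.range m, f i ≤ ∫ y in (0 : ℝ)..m, f y := by
    have := hmono'.sum_le_integral
    simpa using this
  -- antitone piece
  have hB1 : ∑ i ∈ Finset.Ico m M, f (i + 1) ≤ ∫ y in (m : ℝ)..M, f y := by
    have := hanti.sum_le_integral_Ico hmM
    simpa using this
  have hB2 : ∫ y in (m : ℝ)..M, f y ≤ ∑ i ∈ Finset.Ico m M, f i := by
    have := hanti.integral_le_sum_Ico hmM
    simpa using this
  -- telescoping corrections
  have hT1 : ∑ i ∈ Finset.range m, f i - ∑ i ∈ Finset.range m, f (i + 1) = f 0 - f m := by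
    have := Finset.sum_range_sub' (fun i : ℕ ↦ f (i : ℝ)) m
    simp only [Nat.cast_add, Nat.cast_one, Nat.cast_zero] at this
    rw [← Finset.sum_sub_distrib]
    exact this
  have hT2 : ∑ i ∈ Finset.Ico m M, f i - ∑ i ∈ Finset.Ico m M, f (i + 1) = f m - f M := by
    rw [← Finset.sum_sub_distrib, Finset.sum_Ico_eq_sum_range]
    have := Finset.sum_range_sub' (fun k : ℕ ↦ f ((m : ℝ) + k)) (M - m)
    simp only [Nat.cast_zero, add_zero] at this
    have e : ∀ k ∈ Finset.range (M - m),
        f (((m + k : ℕ) : ℝ)) - f (((m + k : ℕ) : ℝ) + 1) =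
          f ((m : ℝ) + k) - f ((m : ℝ) + ((k + 1 : ℕ) : ℝ)) := by
      intro k _; push_cast; ring_nf
    rw [Finset.sum_congr rfl e, this]
    have : ((m : ℝ) + ((M - m : ℕ) : ℝ)) = M := by
      rw [Nat.cast_sub hmM]; ring
    rw [this]
  -- splitting
  have hIsplit : ∫ y in (0 : ℝ)..M, f y = (∫ y in (0 : ℝ)..m, f y) + ∫ y in (m : ℝ)..M, f y := by
    rw [intervalIntegral.integral_add_adjacent_intervals]
    · exact (hmono.mono (by rw [Set.uIcc_of_le (by positivity)])).intervalIntegrable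
    · refine (hanti.mono ?_).intervalIntegrable
      rw [Set.uIcc_of_le (by exact_mod_cast hmM)]
  have hSsplit : ∑ i ∈ Finset.range M, f (i + 1) =
      ∑ i ∈ Finset.range m, f (i + 1) + ∑ i ∈ Finset.Ico m M, f (i + 1) :=
    (Finset.sum_range_add_sum_Ico (fun i : ℕ ↦ f (i + 1)) hmM).symm
  have hf0 := h0 0
  have hfm0 := h0 (m : ℝ)
  have hfm1 := h1 (m : ℝ)
  have hfM0 := h0 (M : ℝ)
  have hf01 := h1 0
  rw [abs_le]
  constructor <;> linarith

/-- **Dilated unimodal Riemann sums.** For `χ` as in `exists_smooth_bump` (continuous, `0` off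
`(0,a)`, values in `[0,1]`, monotone on `(−∞, a−δ]`, antitone on `[δ,∞)`, `∫_0^a χ = a − δ`,
`a ≤ 1`) and a step `0 < u ≤ a − 2δ`: `|u · Σ_{n<N} χ((n+1)u) − (a − δ)| ≤ u` whenever
`N ≥ 1/u` (so that the sum is the full periodization `T(χ)(u)`).
[cite: Burnol2001, §2 (before Thm 2.6)] -/
theorem abs_mul_sum_sub_le {χ : ℝ → ℝ} {a δ u : ℝ} {N : ℕ} (hδ : 0 < δ) (ha : a ≤ 1)
    (hcont : Continuous χ) (hzero : ∀ x, a ≤ x → χ x = 0)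
    (h0 : ∀ x, 0 ≤ χ x) (h1 : ∀ x, χ x ≤ 1)
    (hmono : MonotoneOn χ (Iic (a - δ))) (hanti : AntitoneOn χ (Ici δ))
    (hint : ∫ x in (0 : ℝ)..a, χ x = a - δ)
    (hu : 0 < u) (hua : u ≤ a - 2 * δ) (hN : 1 / u ≤ N) :
    |u * ∑ n ∈ Finset.range N, χ ((n + 1 : ℕ) * u) - (a - δ)| ≤ u := by
  set f : ℝ → ℝ := fun y ↦ χ (u * y) with hf
  set m : ℕ := ⌈δ / u⌉₊ with hm
  have hm1 : δ ≤ u * m := by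
    have : δ / u ≤ m := Nat.le_ceil _
    rwa [div_le_iff₀ hu, mul_comm] at this
  have hm2 : u * m ≤ a - δ := by
    have : (m : ℝ) < δ / u + 1 := Nat.ceil_lt_add_one (div_nonneg hδ.le hu.le)
    have h' : u * m < u * (δ / u + 1) := mul_lt_mul_of_pos_left this hu
    rw [mul_add, mul_div_cancel₀ _ hu.ne', mul_one] at h'
    linarith
  have huN : 1 ≤ u * N := by rwa [div_le_iff₀ hu, mul_comm] at hN
  have hmN : m ≤ N := by
    have : (m : ℝ) < N := by
      by_contra hc
      push Not at hc
      have := mul_le_mul_of_nonneg_left hc hu.le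
      linarith
    exact_mod_cast this.le
  have hf0 : ∀ y, 0 ≤ f y := fun y ↦ h0 _
  have hf1 : ∀ y, f y ≤ 1 := fun y ↦ h1 _
  have hfmono : MonotoneOn f (Icc (0 : ℝ) m) := by
    intro x hx y hy hxy
    apply hmono
    · show u * x ≤ a - δ
      exact le_trans (mul_le_mul_of_nonneg_left hx.2 hu.le) hm2
    · show u * y ≤ a - δ
      exact le_trans (mul_le_mul_of_nonneg_left hy.2 hu.le) hm2
    · exact mul_le_mul_of_nonneg_left hxy hu.le
  have hfanti : AntitoneOn f (Icc (m : ℝ) N) := by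
    intro x hx y hy hxy
    apply hanti
    · show δ ≤ u * x
      exact le_trans hm1 (mul_le_mul_of_nonneg_left hx.1 hu.le)
    · show δ ≤ u * y
      exact le_trans hm1 (mul_le_mul_of_nonneg_left hy.1 hu.le)
    · exact mul_le_mul_of_nonneg_left hxy hu.le
  have key := abs_sum_sub_integral_le_one hmN hf0 hf1 hfmono hfanti
  -- identify the sum
  have hsum : ∑ i ∈ Finset.range N, f (i + 1) = ∑ n ∈ Finset.range N, χ ((n + 1 : ℕ) * u) := by
    refine Finset.sum_congr rfl fun n _ ↦ ?_
    simp only [hf]; push_cast; ring_nf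
  -- identify the integral: `∫_0^N χ(u y) dy = u⁻¹ ∫_0^{uN} χ = u⁻¹ (a − δ)`
  have hI : ∫ y in (0 : ℝ)..N, f y = u⁻¹ * (a - δ) := by
    simp only [hf]
    rw [intervalIntegral.integral_comp_mul_left _ hu.ne', mul_zero, smul_eq_mul]
    congr 1
    have haN : a ≤ u * N := le_trans ha huN
    rw [← intervalIntegral.integral_add_adjacent_intervals (hcont.intervalIntegrable 0 a)
      (hcont.intervalIntegrable a (u * N)), hint]
    have : ∫ x in a..u * N, χ x = ∫ _ in a..u * N, (0 : ℝ) := by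
      refine intervalIntegral.integral_congr fun x hx ↦ ?_
      rw [Set.uIcc_of_le haN] at hx
      exact hzero x hx.1
    rw [this, intervalIntegral.integral_const, smul_zero, add_zero]
  rw [hsum, hI] at key
  have e : u * ∑ n ∈ Finset.range N, χ ((n + 1 : ℕ) * u) - (a - δ) =
      u * (∑ n ∈ Finset.range N, χ ((n + 1 : ℕ) * u) - u⁻¹ * (a - δ)) := by
    field_simp
  rw [e, abs_mul, abs_of_pos hu]
  calc u * |∑ n ∈ Finset.range N, χ ((n + 1 : ℕ) * u) - u⁻¹ * (a - δ)| ≤ u * 1 :=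
        mul_le_mul_of_nonneg_left key hu.le
    _ = u := mul_one u

/-! ## RH ⟹ closure, step 3: `ρ_α` is the periodization of `α𝟙_{(0,1]} − 𝟙_{(0,α]}` -/

/-- Counting: for `u > 0`, `a ≥ 0` and `N ≥ a/u`, `Σ_{n<N} 𝟙_{(0,a]}((n+1)u) = ⌊a/u⌋`.
[cite: Burnol2001, §2 (before Thm 2.1), `ρ_α(u) = {α/u} − α{1/u}`] -/
theorem sum_indicator_Ioc_eq_floor {a u : ℝ} (ha : 0 ≤ a) (hu : 0 < u) {N : ℕ} (hN : a / u ≤ N) :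
    ∑ n ∈ Finset.range N, (Ioc (0 : ℝ) a).indicator (fun _ ↦ (1 : ℝ)) ((n + 1 : ℕ) * u) =
      ⌊a / u⌋₊ := by
  set K := ⌊a / u⌋₊ with hK
  have hKN : K ≤ N := by
    have : (K : ℝ) ≤ N := (Nat.floor_le (div_nonneg ha hu.le)).trans hN
    exact_mod_cast this
  have hiff : ∀ n : ℕ, ((n + 1 : ℕ) : ℝ) * u ∈ Ioc (0 : ℝ) a ↔ n < K := by
    intro n
    rw [mem_Ioc, and_iff_right (by positivity), ← le_div_iff₀ hu, ← Nat.add_one_le_iff, hK,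
      Nat.le_floor_iff (div_nonneg ha hu.le)]
  have hterm : ∀ n : ℕ, (Ioc (0 : ℝ) a).indicator (fun _ ↦ (1 : ℝ)) ((n + 1 : ℕ) * u) =
      if n < K then 1 else 0 := by
    intro n
    by_cases hn : n < K
    · rw [if_pos hn, indicator_of_mem ((hiff n).2 hn)]
    · rw [if_neg hn, indicator_of_notMem ((hiff n).not.2 hn)]
  rw [Finset.sum_congr rfl fun n _ ↦ hterm n, ← Finset.sum_range_add_sum_Ico _ hKN,
    Finset.sum_congr rfl fun n hn ↦ if_pos (Finset.mem_range.1 hn),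
    Finset.sum_congr rfl fun n hn ↦ if_neg (not_lt.2 (Finset.mem_Ico.1 hn).1)]
  simp

/-- `ρ_α(u) = α⌊1/u⌋ − ⌊α/u⌋` for `u > 0`, `α ≥ 0`. [cite: Burnol2001, §2 (before Thm 2.1)] -/
theorem nymanRho_eq_floor {α u : ℝ} (hα : 0 ≤ α) (hu : 0 < u) :
    nymanRho α u = ((α * ⌊1 / u⌋₊ - ⌊α / u⌋₊ : ℝ) : ℂ) := by
  unfold nymanRho
  congr 1
  rw [← Int.self_sub_floor, ← Int.self_sub_floor,
    ← natCast_floor_eq_intCast_floor (div_nonneg hα hu.le),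
    ← natCast_floor_eq_intCast_floor (div_nonneg zero_le_one hu.le)]
  ring

/-- **`ρ_α = T(α·𝟙_{(0,1]} − 𝟙_{(0,α]})`** as a finite periodization: for `0 ≤ α ≤ 1`, `u > 0`
and `N ≥ 1/u`, `Σ_{n<N} (α𝟙_{(0,1]} − 𝟙_{(0,α]})((n+1)u) = ρ_α(u)`.
[cite: Burnol2001, §2 (before Thm 2.6): `K` coincides with Nyman's space `N`] -/
theorem sum_step_eq_nymanRho {α u : ℝ} (hα : 0 ≤ α) (hα1 : α ≤ 1) (hu : 0 < u) {N : ℕ}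
    (hN : 1 / u ≤ N) :
    ∑ n ∈ Finset.range N, (α * (Ioc (0 : ℝ) 1).indicator (fun _ ↦ (1 : ℝ)) ((n + 1 : ℕ) * u) -
        (Ioc (0 : ℝ) α).indicator (fun _ ↦ (1 : ℝ)) ((n + 1 : ℕ) * u)) =
      α * ⌊1 / u⌋₊ - ⌊α / u⌋₊ := by
  have hNα : α / u ≤ N := le_trans (div_le_div_of_nonneg_right hα1 hu.le) hN
  rw [Finset.sum_sub_distrib, ← Finset.mul_sum, sum_indicator_Ioc_eq_floor zero_le_one hu hN,
    sum_indicator_Ioc_eq_floor hα hu hNα]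

/-! ## RH ⟹ closure, step 4: `L²` norms of dilates -/

/-- `‖h(c·)‖_{L²(ℝ)} ≤ ‖h‖_{L²(ℝ)}` for `c ≥ 1` (`= c^{−1/2}‖h‖₂`). [folklore] -/
private theorem eLpNorm_comp_mul_left_le {h : ℝ → ℂ} (hh : Measurable h) {c : ℝ} (hc : 1 ≤ c) :
    eLpNorm (fun u ↦ h (c * u)) 2 volume ≤ eLpNorm h 2 volume := by
  have hc0 : c ≠ 0 := by positivity
  have h1 : eLpNorm (fun u ↦ h (c * u)) 2 volume =
      eLpNorm h 2 (Measure.map (fun u : ℝ ↦ c * u) volume) := by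
    rw [eLpNorm_map_measure hh.aestronglyMeasurable (measurable_const_mul c).aemeasurable]
    rfl
  rw [h1, Real.map_volume_mul_left hc0, eLpNorm_smul_measure_of_ne_top (by norm_num),
    smul_eq_mul]
  refine le_of_le_of_eq (mul_le_mul' ?_ le_rfl) (one_mul _)
  refine ENNReal.rpow_le_one (ENNReal.ofReal_le_one.2 ?_) ENNReal.toReal_nonneg
  rw [abs_of_pos (inv_pos.2 (by positivity))]
  exact inv_le_one_of_one_le₀ hc

/-- `L²` smallness of a bounded function with small support: if `‖d x‖ ≤ 1` everywhere and `d`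
vanishes off a measurable set `S`, then `‖d‖_{L²(ℝ)} ≤ (vol S)^{1/2}`. [folklore] -/
private theorem eLpNorm_le_of_support {d : ℝ → ℂ} {S : Set ℝ} (hS : MeasurableSet S)
    (hd : ∀ x, ‖d x‖ ≤ 1) (hdS : ∀ x, x ∉ S → d x = 0) :
    eLpNorm d 2 volume ≤ volume S ^ (1 / 2 : ℝ) := by
  have hind : d = S.indicator d := by
    funext x
    by_cases hx : x ∈ S
    · rw [indicator_of_mem hx]
    · rw [indicator_of_notMem hx, hdS x hx]
  rw [hind, eLpNorm_indicator_eq_eLpNorm_restrict hS]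
  refine (eLpNorm_le_of_ae_bound (C := 1) (Eventually.of_forall fun x ↦ hd x)).trans ?_
  rw [Measure.restrict_apply_univ, ENNReal.ofReal_one, mul_one]
  simp


/-- `|ρ_α(u)| ≤ 1` for `0 ≤ α ≤ 1` (`ρ_α(u) = {α/u} − α{1/u} ∈ (−α, 1)`).
[cite: Burnol2001, §2 (before Thm 2.1)] -/
theorem norm_nymanRho_le_one {α : ℝ} (hα0 : 0 ≤ α) (hα1 : α ≤ 1) (u : ℝ) :
    ‖nymanRho α u‖ ≤ 1 := by
  unfold nymanRho
  rw [Complex.norm_real, Real.norm_eq_abs, abs_le]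
  have f1 := Int.fract_nonneg (α / u)
  have f2 := Int.fract_lt_one (α / u)
  have f3 := Int.fract_nonneg (1 / u)
  have f4 := Int.fract_lt_one (1 / u)
  have f5 : α * Int.fract (1 / u) ≤ 1 * 1 := mul_le_mul hα1 f4.le f3 zero_le_one
  have f6 : 0 ≤ α * Int.fract (1 / u) := mul_nonneg hα0 f3
  constructor <;> linarith

/-- Bookkeeping for the near-zero bound: if `|uS₁ − (1−δ)| ≤ u`, `|uS_α − (α−δ)| ≤ u` and
`α'(1−δ) = α−δ` with `0 ≤ α' ≤ 1`, then `|α'S₁ − S_α| ≤ 2`. [folklore] -/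
private theorem abs_comb_le_two {u α' S₁ Sα δ α : ℝ} (hu : 0 < u) (hα'0 : 0 ≤ α')
    (hα'1 : α' ≤ 1) (heq : α' * (1 - δ) = α - δ) (h₁ : |u * S₁ - (1 - δ)| ≤ u)
    (h₂ : |u * Sα - (α - δ)| ≤ u) : |α' * S₁ - Sα| ≤ 2 := by
  have e : u * (α' * S₁ - Sα) = α' * (u * S₁ - (1 - δ)) - (u * Sα - (α - δ)) := by
    linear_combination heq
  have hb : |u * (α' * S₁ - Sα)| ≤ 2 * u := by
    rw [e]
    calc |α' * (u * S₁ - (1 - δ)) - (u * Sα - (α - δ))|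
        ≤ |α' * (u * S₁ - (1 - δ))| + |u * Sα - (α - δ)| := abs_sub _ _
      _ = α' * |u * S₁ - (1 - δ)| + |u * Sα - (α - δ)| := by
          rw [abs_mul, abs_of_nonneg hα'0]
      _ ≤ 1 * u + u := add_le_add (mul_le_mul hα'1 h₁ (abs_nonneg _) zero_le_one) h₂
      _ = 2 * u := by ring
  rw [abs_mul, abs_of_pos hu] at hb
  by_contra hc
  push Not at hc
  have : u * 2 < u * |α' * S₁ - Sα| := mul_lt_mul_of_pos_left hc hu
  linarith

/-! ## RH ⟹ closure, step 5: `N ⊂ K` — each `ρ_α` is an `L²(0,1)`-limit of `T(φ)`'s -/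

/-- `‖𝟙_{(0,a]} − χ‖_{L²(ℝ)} ≤ 2√δ` for an approximate indicator `χ` of `(0,a]` that is exact
off `[0,δ] ∪ [a−δ,a]`. [folklore] -/
private theorem eLpNorm_indicator_sub_bump_le {a δ r : ℝ} {χ : ℝ → ℝ} (hδ : 0 < δ)
    (hrsq : r ^ 2 = δ) (hr : 0 ≤ r)
    (hl : ∀ x, x ≤ 0 → χ x = 0) (hrt : ∀ x, a ≤ x → χ x = 0)
    (hm : ∀ x ∈ Icc δ (a - δ), χ x = 1) (h0 : ∀ x, 0 ≤ χ x) (h1 : ∀ x, χ x ≤ 1) :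
    eLpNorm (fun x ↦ (((Ioc (0 : ℝ) a).indicator (fun _ ↦ (1 : ℝ)) x - χ x : ℝ) : ℂ)) 2 volume ≤
      ENNReal.ofReal (2 * r) := by
  have hS : MeasurableSet (Icc (0 : ℝ) δ ∪ Icc (a - δ) a) :=
    measurableSet_Icc.union measurableSet_Icc
  have hle := eLpNorm_le_of_support
    (d := fun x ↦ (((Ioc (0 : ℝ) a).indicator (fun _ ↦ (1 : ℝ)) x - χ x : ℝ) : ℂ)) hS ?_ ?_
  · refine hle.trans ?_
    have hvol : volume (Icc (0 : ℝ) δ ∪ Icc (a - δ) a) ≤ ENNReal.ofReal (2 * δ) := by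
      refine (measure_union_le _ _).trans ?_
      rw [Real.volume_Icc, Real.volume_Icc, sub_zero, show a - (a - δ) = δ by ring,
        ← ENNReal.ofReal_add hδ.le hδ.le, ← two_mul]
    calc volume (Icc (0 : ℝ) δ ∪ Icc (a - δ) a) ^ (1 / 2 : ℝ)
        ≤ ENNReal.ofReal (2 * δ) ^ (1 / 2 : ℝ) := ENNReal.rpow_le_rpow hvol (by norm_num)
      _ = ENNReal.ofReal (Real.sqrt (2 * δ)) := by
          rw [ENNReal.ofReal_rpow_of_nonneg (by linarith) (by norm_num), Real.sqrt_eq_rpow]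
      _ ≤ ENNReal.ofReal (2 * r) := by
          refine ENNReal.ofReal_le_ofReal ?_
          rw [Real.sqrt_le_iff]
          constructor
          · positivity
          · rw [mul_pow, hrsq]; linarith
  · intro x
    rw [Complex.norm_real, Real.norm_eq_abs, abs_le]
    have hIx : (Ioc (0 : ℝ) a).indicator (fun _ ↦ (1 : ℝ)) x = 0 ∨
        (Ioc (0 : ℝ) a).indicator (fun _ ↦ (1 : ℝ)) x = 1 := by
      by_cases hx : x ∈ Ioc (0 : ℝ) a
      · right; rw [indicator_of_mem hx]
      · left; rw [indicator_of_notMem hx]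
    rcases hIx with h | h <;> rw [h] <;> constructor <;> linarith [h0 x, h1 x]
  · intro x hx
    simp only [mem_union, mem_Icc, not_or, not_and_or, not_le] at hx
    rcases hx.1 with hx0 | hxδ
    · rw [indicator_of_notMem (fun h ↦ absurd (Set.mem_Ioc.1 h).1 (not_lt.2 hx0.le)), hl x hx0.le]
      simp
    · rcases hx.2 with hxa | hxa
      · rw [indicator_of_mem (Set.mem_Ioc.2 ⟨by linarith, by linarith⟩), hm x ⟨hxδ.le, hxa.le⟩]
        simp
      · rw [indicator_of_notMem (fun h ↦ absurd (Set.mem_Ioc.1 h).2 (not_le.2 hxa)), hrt x hxa.le]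
        simp

/-- `‖𝟙_{(0,1]}‖_{L²(ℝ)} ≤ 1`. [folklore] -/
private theorem eLpNorm_indicator_Ioc_one_le :
    eLpNorm (fun x ↦ (((Ioc (0 : ℝ) 1).indicator (fun _ ↦ (1 : ℝ)) x : ℝ) : ℂ)) 2 volume ≤ 1 := by
  have hle := eLpNorm_le_of_support
    (d := fun x ↦ (((Ioc (0 : ℝ) 1).indicator (fun _ ↦ (1 : ℝ)) x : ℝ) : ℂ)) (S := Ioc (0 : ℝ) 1)
    measurableSet_Ioc ?_ ?_
  · refine hle.trans ?_
    rw [Real.volume_Ioc, sub_zero, ENNReal.ofReal_one, ENNReal.one_rpow]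
  · intro x
    rw [Complex.norm_real]
    by_cases hx : x ∈ Ioc (0 : ℝ) 1
    · rw [indicator_of_mem hx]; simp
    · rw [indicator_of_notMem hx]; simp
  · intro x hx
    rw [indicator_of_notMem hx, Complex.ofReal_zero]

/-- The three-piece `L²` bound `‖a•D₁ + b•J − D_α‖₂ ≤ 5r` from `‖D₁‖₂, ‖D_α‖₂ ≤ 2r`, `‖J‖₂ ≤ 1`,
`|a| ≤ 1`, `|b| ≤ r`. [folklore] -/
private theorem eLpNorm_three_piece_le {D₁ J Dα : ℝ → ℂ} (hD₁m : Measurable D₁) (hJm : Measurable J)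
    (hDαm : Measurable Dα) {a b r : ℝ} (hr : 0 ≤ r) (ha : |a| ≤ 1) (hb : |b| ≤ r)
    (hD₁ : eLpNorm D₁ 2 volume ≤ ENNReal.ofReal (2 * r))
    (hJ : eLpNorm J 2 volume ≤ 1) (hDα : eLpNorm Dα 2 volume ≤ ENNReal.ofReal (2 * r)) :
    eLpNorm (fun x ↦ ((a : ℂ) • D₁ x + (b : ℂ) • J x) - Dα x) 2 volume ≤
      ENNReal.ofReal (5 * r) := by
  have hm1 : AEStronglyMeasurable (fun x ↦ (a : ℂ) • D₁ x + (b : ℂ) • J x) volume :=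
    (by fun_prop : Measurable fun x ↦ (a : ℂ) • D₁ x + (b : ℂ) • J x).aestronglyMeasurable
  have ha' : ‖(a : ℂ)‖ₑ ≤ ENNReal.ofReal 1 := by
    rw [← ofReal_norm, Complex.norm_real, Real.norm_eq_abs]; exact ENNReal.ofReal_le_ofReal ha
  have hb' : ‖(b : ℂ)‖ₑ ≤ ENNReal.ofReal r := by
    rw [← ofReal_norm, Complex.norm_real, Real.norm_eq_abs]; exact ENNReal.ofReal_le_ofReal hb
  calc eLpNorm (fun x ↦ ((a : ℂ) • D₁ x + (b : ℂ) • J x) - Dα x) 2 volume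
      ≤ eLpNorm (fun x ↦ (a : ℂ) • D₁ x + (b : ℂ) • J x) 2 volume + eLpNorm Dα 2 volume :=
        eLpNorm_sub_le hm1 hDαm.aestronglyMeasurable (by norm_num)
    _ ≤ (eLpNorm (fun x ↦ (a : ℂ) • D₁ x) 2 volume + eLpNorm (fun x ↦ (b : ℂ) • J x) 2 volume) +
          eLpNorm Dα 2 volume := by
        gcongr
        exact eLpNorm_add_le
          (by fun_prop : Measurable fun x ↦ (a : ℂ) • D₁ x).aestronglyMeasurable
          (by fun_prop : Measurable fun x ↦ (b : ℂ) • J x).aestronglyMeasurable (by norm_num)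
    _ = (‖(a : ℂ)‖ₑ * eLpNorm D₁ 2 volume + ‖(b : ℂ)‖ₑ * eLpNorm J 2 volume) +
          eLpNorm Dα 2 volume := by
        rw [← eLpNorm_const_smul, ← eLpNorm_const_smul]; rfl
    _ ≤ (ENNReal.ofReal 1 * ENNReal.ofReal (2 * r) + ENNReal.ofReal r * 1) +
          ENNReal.ofReal (2 * r) := by gcongr
    _ = ENNReal.ofReal (2 * r + r + 2 * r) := by
        rw [ENNReal.ofReal_one, one_mul, mul_one, ← ENNReal.ofReal_add (by positivity) hr,
          ← ENNReal.ofReal_add (by positivity) (by positivity)]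
    _ = ENNReal.ofReal (5 * r) := by ring_nf

/-- Near-zero piece: a pointwise bound `‖E‖ ≤ C` on `(0,u₀]` gives
`‖𝟙_{(0,u₀]} E‖_{L²(0,1)} ≤ C √u₀`. [folklore] -/
private theorem eLpNorm_indicator_near_le {E : ℝ → ℂ} {u₀ C : ℝ} (hu₀ : 0 < u₀) (hu₀1 : u₀ < 1)
    (hE : ∀ u ∈ Ioc (0 : ℝ) u₀, ‖E u‖ ≤ C) :
    eLpNorm ((Ioc (0 : ℝ) u₀).indicator E) 2 (volume.restrict (Ioo (0 : ℝ) 1)) ≤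
      ENNReal.ofReal (C * Real.sqrt u₀) := by
  rw [eLpNorm_indicator_eq_eLpNorm_restrict measurableSet_Ioc,
    Measure.restrict_restrict measurableSet_Ioc, inter_eq_left.2 (Ioc_subset_Ioo_right hu₀1)]
  refine (eLpNorm_le_of_ae_bound (C := C) ?_).trans (le_of_eq ?_)
  · filter_upwards [ae_restrict_mem measurableSet_Ioc] with u hu using hE u hu
  · rw [Measure.restrict_apply_univ, Real.volume_Ioc, sub_zero, ENNReal.toReal_ofNat,
      ENNReal.ofReal_rpow_of_nonneg hu₀.le (by norm_num), ← one_div, ← Real.sqrt_eq_rpow,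
      ← ENNReal.ofReal_mul (Real.sqrt_nonneg _), mul_comm]

/-- Far piece: if on a measurable set `S` the function `E` is the sum of the `N` dilates
`h((n+1)·)`, `n < N`, of a measurable `h` with `‖h‖_{L²(ℝ)} ≤ b`, then `‖E‖_{L²(S)} ≤ N b`.
[folklore] -/
private theorem eLpNorm_far_le {E h : ℝ → ℂ} {S : Set ℝ} (hS : MeasurableSet S) (hh : Measurable h)
    {N : ℕ} {b : ℝ} (hb : eLpNorm h 2 volume ≤ ENNReal.ofReal b)
    (hE : ∀ u ∈ S, E u = ∑ n ∈ Finset.range N, h ((n + 1 : ℕ) * u)) :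
    eLpNorm E 2 (volume.restrict S) ≤ (N : ENNReal) * ENNReal.ofReal b := by
  have heq : eLpNorm E 2 (volume.restrict S) =
      eLpNorm (∑ n ∈ Finset.range N, fun u : ℝ ↦ h ((n + 1 : ℕ) * u)) 2 (volume.restrict S) := by
    refine eLpNorm_congr_ae ?_
    filter_upwards [ae_restrict_mem hS] with u hu
    rw [hE u hu, Finset.sum_apply]
  rw [heq]
  calc eLpNorm (∑ n ∈ Finset.range N, fun u : ℝ ↦ h ((n + 1 : ℕ) * u)) 2 (volume.restrict S)
      ≤ ∑ n ∈ Finset.range N, eLpNorm (fun u : ℝ ↦ h ((n + 1 : ℕ) * u)) 2 (volume.restrict S) :=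
        eLpNorm_sum_le (fun n _ ↦
          (hh.comp (measurable_const.mul measurable_id)).aestronglyMeasurable) (by norm_num)
    _ ≤ ∑ n ∈ Finset.range N, ENNReal.ofReal b := by
        gcongr with n hn
        refine (eLpNorm_mono_measure _ Measure.restrict_le_self).trans ?_
        exact (eLpNorm_comp_mul_left_le hh (by exact_mod_cast Nat.succ_le_succ (Nat.zero_le n))).trans hb
    _ = (N : ENNReal) * ENNReal.ofReal b := by
        rw [Finset.sum_const, Finset.card_range, nsmul_eq_mul]

/-- Splitting an `L²((0,1))` norm at `u₀`. [folklore] -/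
private theorem eLpNorm_split_le {E : ℝ → ℂ} {u₀ : ℝ}
    (hEm : AEStronglyMeasurable E (volume.restrict (Ioo (0 : ℝ) 1))) :
    eLpNorm E 2 (volume.restrict (Ioo (0 : ℝ) 1)) ≤
      eLpNorm ((Ioc (0 : ℝ) u₀).indicator E) 2 (volume.restrict (Ioo (0 : ℝ) 1)) +
        eLpNorm E 2 (volume.restrict (Ioi u₀ ∩ Ioo (0 : ℝ) 1)) := by
  have heq : eLpNorm E 2 (volume.restrict (Ioo (0 : ℝ) 1)) =
      eLpNorm (fun u ↦ (Ioc (0 : ℝ) u₀).indicator E u + (Ioi u₀).indicator E u) 2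
        (volume.restrict (Ioo (0 : ℝ) 1)) := by
    refine eLpNorm_congr_ae ?_
    filter_upwards [ae_restrict_mem measurableSet_Ioo] with u hu
    by_cases h : u ≤ u₀
    · rw [indicator_of_mem (Set.mem_Ioc.2 ⟨hu.1, h⟩),
        indicator_of_notMem (fun h' ↦ absurd (Set.mem_Ioi.1 h') (not_lt.2 h)), add_zero]
    · rw [indicator_of_notMem (fun h' ↦ h (Set.mem_Ioc.1 h').2),
        indicator_of_mem (Set.mem_Ioi.2 (not_le.1 h)), zero_add]
  rw [heq]
  refine (eLpNorm_add_le (hEm.indicator measurableSet_Ioc) (hEm.indicator measurableSet_Ioi)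
    (by norm_num)).trans (le_of_eq ?_)
  rw [eLpNorm_indicator_eq_eLpNorm_restrict measurableSet_Ioi,
    Measure.restrict_restrict measurableSet_Ioi]

/-- **`N ⊂ K`.** For `0 < α < 1` and `η > 0` there is `φ ∈ 𝒮⁰_{≤1}` with
`‖ρ_α − T(φ)‖_{L²(0,1)} ≤ η`: take `φ = α'χ_{1,δ} − χ_{α,δ}` (`exists_smooth_bump`,
`α' = (α−δ)/(1−δ)`); near `0` the unimodal Riemann-sum bound gives `|ρ_α − T(φ)| ≤ 3`, and on
`(u₀,1)` the `⌈1/u₀⌉` dilates of the difference of `φ` and the step function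
`α𝟙_{(0,1]} − 𝟙_{(0,α]}` (whose periodization is `ρ_α`) have `L²` norm `O(√δ)` each.
[cite: Burnol2001, §2 (before Thm 2.6): "The conclusion is that `K` coincides with the space `N`
considered by Nyman"] -/
theorem exists_isTest0_approx_nymanRho {α : ℝ} (hα : 0 < α) (hα1 : α < 1) {η : ℝ} (hη : 0 < η) :
    ∃ φ : ℝ → ℂ, IsTest0 φ ∧
      eLpNorm (fun u ↦ nymanRho α u - mapT φ u) 2 (volume.restrict (Ioo (0 : ℝ) 1)) ≤
        ENNReal.ofReal η := by
  ------------------------------------------------------------------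
  -- constants: the cut-off `u₀`, the number of dilates `N`, the smoothing width `δ`
  ------------------------------------------------------------------
  set u₀ : ℝ := min (α / 2) (η ^ 2 / 36) with hu₀
  have hu₀pos : 0 < u₀ := lt_min (by positivity) (by positivity)
  have hu₀α : u₀ ≤ α / 2 := min_le_left _ _
  have hu₀η : u₀ ≤ η ^ 2 / 36 := min_le_right _ _
  have hu₀1 : u₀ < 1 := by linarith
  set N : ℕ := ⌈1 / u₀⌉₊ with hN
  have hN1 : 1 / u₀ ≤ N := Nat.le_ceil _
  have hNpos : (0 : ℝ) < (N : ℝ) + 1 := by positivity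
  set δ : ℝ := min (α / 4) (η ^ 2 / (100 * ((N : ℝ) + 1) ^ 2)) with hδ
  have hδpos : 0 < δ := lt_min (by positivity) (by positivity)
  have hδα : δ ≤ α / 4 := min_le_left _ _
  have hδη : δ ≤ η ^ 2 / (100 * ((N : ℝ) + 1) ^ 2) := min_le_right _ _
  have hδ4 : δ ≤ 1 / 4 := by linarith
  set r : ℝ := Real.sqrt δ with hr
  have hr0 : 0 ≤ r := Real.sqrt_nonneg _
  have hrsq : r ^ 2 = δ := Real.sq_sqrt hδpos.le
  have hr2 : r ≤ 1 / 2 := by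
    rw [show (1 / 2 : ℝ) = Real.sqrt (1 / 4) by
      rw [show (1 / 4 : ℝ) = (1 / 2) ^ 2 by norm_num, Real.sqrt_sq (by norm_num)]]
    exact Real.sqrt_le_sqrt hδ4
  have hδr : 2 * δ ≤ r := by
    calc 2 * δ = (2 * r) * r := by rw [← hrsq]; ring
      _ ≤ (2 * r) * (1 / 2) := mul_le_mul_of_nonneg_left hr2 (by positivity)
      _ = r := by ring
  have hrη : r ≤ η / (10 * ((N : ℝ) + 1)) := by
    have h1 : Real.sqrt (η ^ 2 / (100 * ((N : ℝ) + 1) ^ 2)) = η / (10 * ((N : ℝ) + 1)) := by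
      rw [show η ^ 2 / (100 * ((N : ℝ) + 1) ^ 2) = (η / (10 * ((N : ℝ) + 1))) ^ 2 by
        field_simp; ring]
      exact Real.sqrt_sq (by positivity)
    rw [← h1]; exact Real.sqrt_le_sqrt hδη
  have hu₀sqrt : Real.sqrt u₀ ≤ η / 6 := by
    have h1 : Real.sqrt (η ^ 2 / 36) = η / 6 := by
      rw [show η ^ 2 / 36 = (η / 6) ^ 2 by ring]
      exact Real.sqrt_sq (by positivity)
    rw [← h1]; exact Real.sqrt_le_sqrt hu₀η
  ------------------------------------------------------------------
  -- the bumps and the test function `φ = α'χ₁ − χ_α`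
  ------------------------------------------------------------------
  obtain ⟨χ₁, hχ₁s, hχ₁l, hχ₁r, hχ₁m, hχ₁0, hχ₁1, hχ₁mono, hχ₁anti, hχ₁int⟩ :=
    exists_smooth_bump (a := (1 : ℝ)) hδpos (by linarith)
  obtain ⟨χα, hχαs, hχαl, hχαr, hχαm, hχα0, hχα1, hχαmono, hχαanti, hχαint⟩ :=
    exists_smooth_bump (a := α) hδpos (by linarith)
  have hχ₁c : Continuous χ₁ := hχ₁s.continuous
  have hχαc : Continuous χα := hχαs.continuous
  set α' : ℝ := (α - δ) / (1 - δ) with hα'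
  have h1δ : 0 < 1 - δ := by linarith
  have hα'0 : 0 ≤ α' := div_nonneg (by linarith) h1δ.le
  have hα'1 : α' ≤ 1 := by rw [div_le_one h1δ]; linarith
  have hα'eq : α' * (1 - δ) = α - δ := div_mul_cancel₀ _ h1δ.ne'
  have hαα' : |α - α'| ≤ 2 * δ := by
    have e : α - α' = δ * (1 - α) / (1 - δ) := by
      rw [hα']; field_simp; ring
    rw [e, abs_of_nonneg (div_nonneg (mul_nonneg hδpos.le (by linarith)) h1δ.le),
      div_le_iff₀ h1δ]
    have i1 : δ * (1 - α) ≤ δ * 1 := mul_le_mul_of_nonneg_left (by linarith) hδpos.le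
    have i2 : 0 ≤ δ * (1 - 2 * δ) := mul_nonneg hδpos.le (by linarith)
    have i3 : 2 * δ * (1 - δ) = δ + δ * (1 - 2 * δ) := by ring
    linarith
  set ψ : ℝ → ℝ := fun x ↦ α' * χ₁ x - χα x with hψ
  set φ : ℝ → ℂ := fun x ↦ ((ψ x : ℝ) : ℂ) with hφ
  have hψc : Continuous ψ := (continuous_const.mul hχ₁c).sub hχαc
  have hψl : ∀ x, x ≤ 0 → ψ x = 0 := fun x hx ↦ by
    simp only [hψ, hχ₁l x hx, hχαl x hx, mul_zero, sub_zero]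
  have hψr : ∀ x, 1 ≤ x → ψ x = 0 := fun x hx ↦ by
    simp only [hψ, hχ₁r x hx, hχαr x (by linarith), mul_zero, sub_zero]
  have hφtest : IsTest0 φ := by
    refine ⟨?_, ?_, ?_⟩
    · have hψs : ContDiff ℝ ∞ ψ := (contDiff_const.mul hχ₁s).sub hχαs
      exact Complex.ofRealCLM.contDiff.comp hψs
    · intro x hx
      rw [Function.mem_support] at hx
      by_contra hx'
      rw [mem_Icc, not_and_or, not_le, not_le] at hx'
      apply hx
      rcases hx' with h | h
      · simp only [hφ, hψl x h.le, Complex.ofReal_zero]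
      · simp only [hφ, hψr x h.le, Complex.ofReal_zero]
    · rw [integral_Icc_eq_integral_Ioc, ← intervalIntegral.integral_of_le zero_le_one]
      simp only [hφ]
      rw [intervalIntegral.integral_ofReal]
      have hIα : ∫ x in (0 : ℝ)..1, χα x = α - δ := by
        rw [← intervalIntegral.integral_add_adjacent_intervals (hχαc.intervalIntegrable 0 α)
          (hχαc.intervalIntegrable α 1), hχαint]
        have : ∫ x in α..(1 : ℝ), χα x = ∫ _ in α..(1 : ℝ), (0 : ℝ) := by
          refine intervalIntegral.integral_congr fun x hx ↦ ?_
          rw [Set.uIcc_of_le hα1.le] at hx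
          exact hχαr x hx.1
        rw [this, intervalIntegral.integral_const, smul_zero, add_zero]
      have hI : ∫ x in (0 : ℝ)..1, ψ x = 0 := by
        simp only [hψ]
        rw [intervalIntegral.integral_sub ((hχ₁c.intervalIntegrable _ _).const_mul α')
          (hχαc.intervalIntegrable _ _), intervalIntegral.integral_const_mul, hχ₁int, hIα, hα'eq,
          sub_self]
      rw [hI, Complex.ofReal_zero]
  refine ⟨φ, hφtest, ?_⟩
  ------------------------------------------------------------------
  -- the error `E = ρ_α − T(φ)` and its measurability
  ------------------------------------------------------------------
  set E : ℝ → ℂ := fun u ↦ nymanRho α u - mapT φ u with hE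
  have hEm : AEStronglyMeasurable E (volume.restrict (Ioo (0 : ℝ) 1)) :=
    (measurable_nymanRho α).aestronglyMeasurable.sub
      (hφtest.aestronglyMeasurable_mapT.mono_measure
        (Measure.restrict_mono_set _ Ioo_subset_Ioi_self))
  ------------------------------------------------------------------
  -- (i) near zero: `‖E u‖ ≤ 3` on `(0, u₀]`
  ------------------------------------------------------------------
  have hnear : ∀ u ∈ Ioc (0 : ℝ) u₀, ‖E u‖ ≤ 3 := by
    intro u hu
    have hu0 : 0 < u := hu.1
    have hu1 : u ≤ 1 - 2 * δ := by linarith [hu.2]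
    have huα : u ≤ α - 2 * δ := by linarith [hu.2]
    set M : ℕ := ⌈1 / u⌉₊ with hM
    have hM1 : 1 / u ≤ M := Nat.le_ceil _
    set S₁ : ℝ := ∑ n ∈ Finset.range M, χ₁ ((n + 1 : ℕ) * u) with hS₁
    set Sα : ℝ := ∑ n ∈ Finset.range M, χα ((n + 1 : ℕ) * u) with hSα
    have h₁ : |u * S₁ - (1 - δ)| ≤ u :=
      abs_mul_sum_sub_le hδpos le_rfl hχ₁c hχ₁r hχ₁0 hχ₁1 hχ₁mono hχ₁anti hχ₁int hu0 hu1 hM1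
    have h₂ : |u * Sα - (α - δ)| ≤ u :=
      abs_mul_sum_sub_le hδpos hα1.le hχαc hχαr hχα0 hχα1 hχαmono hχαanti hχαint hu0 huα hM1
    have hT : mapT φ u = ((α' * S₁ - Sα : ℝ) : ℂ) := by
      rw [hφtest.mapT_eq_sum_range hu0 hM1]
      simp only [hφ, hψ, hS₁, hSα]
      push_cast
      rw [Finset.sum_sub_distrib, Finset.mul_sum]
    have hTb : |α' * S₁ - Sα| ≤ 2 := abs_comb_le_two hu0 hα'0 hα'1 hα'eq h₁ h₂
    calc ‖E u‖ ≤ ‖nymanRho α u‖ + ‖mapT φ u‖ := norm_sub_le _ _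
      _ ≤ 1 + 2 := by
          refine add_le_add (norm_nymanRho_le_one hα.le hα1.le u) ?_
          rw [hT, Complex.norm_real, Real.norm_eq_abs]
          exact hTb
      _ = 3 := by norm_num
  ------------------------------------------------------------------
  -- (ii) away from zero: `E = Σ_{n<N} h((n+1)·)` on `(u₀, 1)`, `‖h‖₂ ≤ 5r`
  ------------------------------------------------------------------
  set I₁ : ℝ → ℝ := (Ioc (0 : ℝ) 1).indicator fun _ ↦ (1 : ℝ) with hI₁
  set Iα : ℝ → ℝ := (Ioc (0 : ℝ) α).indicator fun _ ↦ (1 : ℝ) with hIα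
  have hI₁m : Measurable I₁ := measurable_const.indicator measurableSet_Ioc
  have hIαm : Measurable Iα := measurable_const.indicator measurableSet_Ioc
  set D₁ : ℝ → ℂ := fun x ↦ ((I₁ x - χ₁ x : ℝ) : ℂ) with hD₁
  set Dα : ℝ → ℂ := fun x ↦ ((Iα x - χα x : ℝ) : ℂ) with hDα
  set J₁ : ℝ → ℂ := fun x ↦ ((I₁ x : ℝ) : ℂ) with hJ₁
  have hD₁m : Measurable D₁ := Complex.measurable_ofReal.comp (hI₁m.sub hχ₁c.measurable)
  have hDαm : Measurable Dα := Complex.measurable_ofReal.comp (hIαm.sub hχαc.measurable)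
  have hJ₁m : Measurable J₁ := Complex.measurable_ofReal.comp hI₁m
  set hfun : ℝ → ℂ := fun x ↦ ((α' : ℂ) • D₁ x + ((α - α' : ℝ) : ℂ) • J₁ x) - Dα x with hhfun
  have hhm : Measurable hfun := by rw [hhfun]; fun_prop
  have hfar_eq : ∀ u ∈ Ioi u₀ ∩ Ioo (0 : ℝ) 1,
      E u = ∑ n ∈ Finset.range N, hfun ((n + 1 : ℕ) * u) := by
    intro u hu
    have hu0 : 0 < u := hu.2.1
    have huN : 1 / u ≤ N :=
      le_trans (one_div_le_one_div_of_le hu₀pos (le_of_lt hu.1)) hN1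
    have e1 : E u = ((α * ⌊1 / u⌋₊ - ⌊α / u⌋₊ : ℝ) : ℂ) -
        ∑ n ∈ Finset.range N, φ ((n + 1 : ℕ) * u) := by
      simp only [hE]
      rw [hφtest.mapT_eq_sum_range hu0 huN, nymanRho_eq_floor hα.le hu0]
    rw [e1, ← sum_step_eq_nymanRho hα.le hα1.le hu0 huN, Complex.ofReal_sum,
      ← Finset.sum_sub_distrib]
    refine Finset.sum_congr rfl fun n _ ↦ ?_
    simp only [hhfun, hD₁, hDα, hJ₁, hφ, hψ, hI₁, hIα, smul_eq_mul]
    push_cast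
    ring
  have hhb : eLpNorm hfun 2 volume ≤ ENNReal.ofReal (5 * r) :=
    eLpNorm_three_piece_le hD₁m hJ₁m hDαm hr0
      (by rw [abs_of_nonneg hα'0]; exact hα'1) (hαα'.trans hδr)
      (eLpNorm_indicator_sub_bump_le hδpos hrsq hr0 hχ₁l hχ₁r hχ₁m hχ₁0 hχ₁1)
      eLpNorm_indicator_Ioc_one_le
      (eLpNorm_indicator_sub_bump_le hδpos hrsq hr0 hχαl hχαr hχαm hχα0 hχα1)
  ------------------------------------------------------------------
  -- (iii) assemble
  ------------------------------------------------------------------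
  have hA : eLpNorm ((Ioc (0 : ℝ) u₀).indicator E) 2 (volume.restrict (Ioo (0 : ℝ) 1)) ≤
      ENNReal.ofReal (η / 2) :=
    (eLpNorm_indicator_near_le hu₀pos hu₀1 hnear).trans
      (ENNReal.ofReal_le_ofReal (by linarith [hu₀sqrt]))
  have hB : eLpNorm E 2 (volume.restrict (Ioi u₀ ∩ Ioo (0 : ℝ) 1)) ≤ ENNReal.ofReal (η / 2) := by
    refine (eLpNorm_far_le (measurableSet_Ioi.inter measurableSet_Ioo) hhm hhb hfar_eq).trans ?_
    rw [← ENNReal.ofReal_natCast, ← ENNReal.ofReal_mul (Nat.cast_nonneg _)]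
    refine ENNReal.ofReal_le_ofReal ?_
    have h1 : (N : ℝ) * (5 * r) ≤ (N : ℝ) * (5 * (η / (10 * ((N : ℝ) + 1)))) :=
      mul_le_mul_of_nonneg_left (mul_le_mul_of_nonneg_left hrη (by norm_num)) (Nat.cast_nonneg _)
    refine h1.trans ?_
    rw [show (N : ℝ) * (5 * (η / (10 * ((N : ℝ) + 1)))) = η / 2 * ((N : ℝ) / ((N : ℝ) + 1)) by
      field_simp; ring]
    have h2 : (N : ℝ) / ((N : ℝ) + 1) ≤ 1 := by
      rw [div_le_one hNpos]; linarith
    exact mul_le_of_le_one_right (by positivity) h2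
  calc eLpNorm E 2 (volume.restrict (Ioo (0 : ℝ) 1))
      ≤ eLpNorm ((Ioc (0 : ℝ) u₀).indicator E) 2 (volume.restrict (Ioo (0 : ℝ) 1)) +
          eLpNorm E 2 (volume.restrict (Ioi u₀ ∩ Ioo (0 : ℝ) 1)) := eLpNorm_split_le hEm
    _ ≤ ENNReal.ofReal (η / 2) + ENNReal.ofReal (η / 2) := add_le_add hA hB
    _ = ENNReal.ofReal η := by
        rw [← ENNReal.ofReal_add (by positivity) (by positivity)]; ring_nf

end Burnol2001


/-! ## RH ⟹ closure -/

/-- **Thm 2.6, ⟹.** Under RH, `𝟏` on `(0,1)` is an `L²((0,1))`-limit of periodizations `T(φ)`,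
`φ ∈ 𝒮⁰_{≤1}`: Nyman's criterion (`nyman_closure_of_riemannHypothesis`) gives
`‖𝟏 − Σ c_i ρ_{α_i}‖₂ < ε/2`, and `N ⊂ K` (`Burnol2001.exists_isTest0_approx_nymanRho`) replaces
each `ρ_{α_i}` by some `T(φ_i)`; `T` is linear and `𝒮⁰_{≤1}` is a vector space.
[cite: Burnol2001, Thm 2.6 (⟹)] -/
theorem periodization_closure_of_riemannHypothesis (hRH : RiemannHypothesis) :
    ∀ ε : ℝ, 0 < ε → ∃ φ : ℝ → ℂ, IsTest0 φ ∧
      eLpNorm (fun u : ℝ ↦ (1 : ℂ) - mapT φ u) 2 (volume.restrict (Ioo (0 : ℝ) 1)) <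
        ENNReal.ofReal ε := by
  intro ε hε
  have hε2 : 0 < ε / 2 := by positivity
  obtain ⟨n, α, c, hα, hN⟩ := nyman_closure_of_riemannHypothesis hRH (ε / 2) hε2
  -- approximate each `ρ_{α i}` by a periodization
  set η : Fin n → ℝ := fun i ↦ ε / (2 * ((n : ℝ) + 1) * (‖c i‖ + 1)) with hηdef
  have hη : ∀ i : Fin n, 0 < η i := fun i ↦ by positivity
  choose φs hφs hest using fun i : Fin n ↦
    exists_isTest0_approx_nymanRho (hα i).1 (hα i).2 (hη i)
  set φ : ℝ → ℂ := fun x ↦ ∑ i, c i * φs i x with hφ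
  have hφtest : IsTest0 φ := by
    refine ⟨?_, ?_, ?_⟩
    · exact ContDiff.sum fun i _ ↦ contDiff_const.mul (hφs i).1
    · intro x hx
      by_contra hx'
      apply hx
      simp only [hφ]
      refine Finset.sum_eq_zero fun i _ ↦ ?_
      have : φs i x = 0 := by
        by_contra h
        exact hx' ((hφs i).2.1 (Function.mem_support.2 h))
      rw [this, mul_zero]
    · simp only [hφ]
      rw [integral_finsetSum _ (fun i _ ↦
        ((hφs i).continuous.integrableOn_Icc (a := (0 : ℝ)) (b := 1)).const_mul (c i))]
      refine Finset.sum_eq_zero fun i _ ↦ ?_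
      rw [integral_const_mul, (hφs i).2.2, mul_zero]
  refine ⟨φ, hφtest, ?_⟩
  set μ1 : Measure ℝ := volume.restrict (Ioo (0 : ℝ) 1) with hμ1
  -- `T` is linear on these finite sums
  have hT : ∀ u ∈ Ioo (0 : ℝ) 1, mapT φ u = ∑ i, c i * mapT (φs i) u := by
    intro u hu
    set M : ℕ := ⌈1 / u⌉₊ with hM
    have hM1 : 1 / u ≤ M := Nat.le_ceil _
    rw [hφtest.mapT_eq_sum_range hu.1 hM1]
    simp only [hφ]
    rw [Finset.sum_comm]
    refine Finset.sum_congr rfl fun i _ ↦ ?_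
    rw [(hφs i).mapT_eq_sum_range hu.1 hM1, Finset.mul_sum]
  have hdecomp : ∀ u ∈ Ioo (0 : ℝ) 1, (1 : ℂ) - mapT φ u =
      ((1 : ℂ) - ∑ i, c i * nymanRho (α i) u) +
        ∑ i, c i * (nymanRho (α i) u - mapT (φs i) u) := by
    intro u hu
    rw [hT u hu]
    simp only [mul_sub, Finset.sum_sub_distrib]
    ring
  have heq : eLpNorm (fun u : ℝ ↦ (1 : ℂ) - mapT φ u) 2 μ1 =
      eLpNorm (fun u ↦ ((1 : ℂ) - ∑ i, c i * nymanRho (α i) u) +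
        ∑ i, c i * (nymanRho (α i) u - mapT (φs i) u)) 2 μ1 := by
    refine eLpNorm_congr_ae ?_
    filter_upwards [ae_restrict_mem measurableSet_Ioo] with u hu
    exact hdecomp u hu
  rw [heq]
  -- measurability
  have hm1 : AEStronglyMeasurable (fun u : ℝ ↦ (1 : ℂ) - ∑ i, c i * nymanRho (α i) u) μ1 :=
    (measurable_const.sub (Finset.measurable_sum _ fun i _ ↦
      measurable_const.mul (measurable_nymanRho (α i)))).aestronglyMeasurable
  have hm2 : ∀ i, AEStronglyMeasurable
      (fun u : ℝ ↦ c i * (nymanRho (α i) u - mapT (φs i) u)) μ1 := fun i ↦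
    ((measurable_nymanRho (α i)).aestronglyMeasurable.sub
      ((hφs i).aestronglyMeasurable_mapT.mono_measure
        (Measure.restrict_mono_set _ Ioo_subset_Ioi_self))).const_mul (c i)
  have hm3 : AEStronglyMeasurable
      (fun u : ℝ ↦ ∑ i, c i * (nymanRho (α i) u - mapT (φs i) u)) μ1 := by
    have e : (fun u : ℝ ↦ ∑ i, c i * (nymanRho (α i) u - mapT (φs i) u)) =
        ∑ i, fun u : ℝ ↦ c i * (nymanRho (α i) u - mapT (φs i) u) := by
      funext u; rw [Finset.sum_apply]
    rw [e]
    exact Finset.aestronglyMeasurable_sum _ fun i _ ↦ hm2 i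
  -- the termwise bounds
  have hterm : ∀ i, eLpNorm (fun u : ℝ ↦ c i * (nymanRho (α i) u - mapT (φs i) u)) 2 μ1 ≤
      ENNReal.ofReal (ε / (2 * ((n : ℝ) + 1))) := by
    intro i
    have e : eLpNorm (fun u : ℝ ↦ c i * (nymanRho (α i) u - mapT (φs i) u)) 2 μ1 =
        ‖c i‖ₑ * eLpNorm (fun u : ℝ ↦ nymanRho (α i) u - mapT (φs i) u) 2 μ1 := by
      rw [← eLpNorm_const_smul]; rfl
    rw [e, ← ofReal_norm]
    calc ENNReal.ofReal ‖c i‖ * eLpNorm (fun u : ℝ ↦ nymanRho (α i) u - mapT (φs i) u) 2 μ1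
        ≤ ENNReal.ofReal ‖c i‖ * ENNReal.ofReal (η i) := by gcongr; exact hest i
      _ = ENNReal.ofReal (‖c i‖ * η i) := (ENNReal.ofReal_mul (norm_nonneg _)).symm
      _ ≤ ENNReal.ofReal (ε / (2 * ((n : ℝ) + 1))) := by
          refine ENNReal.ofReal_le_ofReal ?_
          have hc1 : 0 < ‖c i‖ + 1 := by positivity
          have hn1 : (0 : ℝ) < 2 * ((n : ℝ) + 1) := by positivity
          rw [hηdef]
          rw [show ‖c i‖ * (ε / (2 * ((n : ℝ) + 1) * (‖c i‖ + 1))) =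
            ε / (2 * ((n : ℝ) + 1)) * (‖c i‖ / (‖c i‖ + 1)) by field_simp]
          have : ‖c i‖ / (‖c i‖ + 1) ≤ 1 := by rw [div_le_one hc1]; linarith
          exact mul_le_of_le_one_right (by positivity) this
  have hsum : eLpNorm (fun u : ℝ ↦ ∑ i, c i * (nymanRho (α i) u - mapT (φs i) u)) 2 μ1 ≤
      ENNReal.ofReal (ε / 2) := by
    have e : (fun u : ℝ ↦ ∑ i, c i * (nymanRho (α i) u - mapT (φs i) u)) =
        ∑ i, fun u : ℝ ↦ c i * (nymanRho (α i) u - mapT (φs i) u) := by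
      funext u; rw [Finset.sum_apply]
    rw [e]
    calc eLpNorm (∑ i, fun u : ℝ ↦ c i * (nymanRho (α i) u - mapT (φs i) u)) 2 μ1
        ≤ ∑ i, eLpNorm (fun u : ℝ ↦ c i * (nymanRho (α i) u - mapT (φs i) u)) 2 μ1 :=
          eLpNorm_sum_le (fun i _ ↦ hm2 i) (by norm_num)
      _ ≤ ∑ _i : Fin n, ENNReal.ofReal (ε / (2 * ((n : ℝ) + 1))) :=
          Finset.sum_le_sum fun i _ ↦ hterm i
      _ = ENNReal.ofReal ((n : ℝ) * (ε / (2 * ((n : ℝ) + 1)))) := by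
          rw [Finset.sum_const, Finset.card_univ, Fintype.card_fin, nsmul_eq_mul,
            ← ENNReal.ofReal_natCast, ← ENNReal.ofReal_mul (Nat.cast_nonneg _)]
      _ ≤ ENNReal.ofReal (ε / 2) := by
          refine ENNReal.ofReal_le_ofReal ?_
          have hn1 : (0 : ℝ) < (n : ℝ) + 1 := by positivity
          rw [show (n : ℝ) * (ε / (2 * ((n : ℝ) + 1))) = ε / 2 * ((n : ℝ) / ((n : ℝ) + 1)) by
            field_simp]
          have : (n : ℝ) / ((n : ℝ) + 1) ≤ 1 := by rw [div_le_one hn1]; linarith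
          exact mul_le_of_le_one_right hε2.le this
  calc eLpNorm (fun u ↦ ((1 : ℂ) - ∑ i, c i * nymanRho (α i) u) +
        ∑ i, c i * (nymanRho (α i) u - mapT (φs i) u)) 2 μ1
      ≤ eLpNorm (fun u : ℝ ↦ (1 : ℂ) - ∑ i, c i * nymanRho (α i) u) 2 μ1 +
          eLpNorm (fun u : ℝ ↦ ∑ i, c i * (nymanRho (α i) u - mapT (φs i) u)) 2 μ1 :=
        eLpNorm_add_le hm1 hm3 (by norm_num)
    _ < ENNReal.ofReal (ε / 2) + ENNReal.ofReal (ε / 2) :=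
        ENNReal.add_lt_add_of_lt_of_le (ne_top_of_le_ne_top ENNReal.ofReal_ne_top hsum) hN hsum
    _ = ENNReal.ofReal ε := by
        rw [← ENNReal.ofReal_add hε2.le hε2.le]; ring_nf

/-! ## The discharge -/

/-- **Burnol 2001, Thm 2.6** (discharge of the named fact
`Literature.NumberTheory.LFunctions.Burnol2001_thm_2_6`): the Riemann hypothesis holds if and only
if the constant function `𝟏` belongs to the closure in `L²((0,1), du)` of
`{T(φ) : φ ∈ 𝒮⁰_{≤1}}`. PROVED AS AN EQUIVALENCE (neither side asserted), by the elementary road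
through Nyman's criterion (`Burnol2001_thm_2_1_holds`, itself through the tree's Báez-Duarte
theorem). [cite: Burnol2001, Thm 2.6 (arXiv v3 l.460–463)] -/
theorem Burnol2001_thm_2_6_holds : Burnol2001_thm_2_6 :=
  ⟨periodization_closure_of_riemannHypothesis, riemannHypothesis_of_periodization_closure⟩

end Literature.NumberTheory.LFunctions

end
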